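import Literature.MathematicalPhysics.QuantumFieldTheory.Balaban1983to89.B9SectBE4FrameCodedY
import Literature.MathematicalPhysics.QuantumFieldTheory.Balaban1983to89.B9Ineq344LocalPairHolds

/-!
# `Balaban1983to89.B9SectBH2FrameCodedY` — ★★ THE (3.45) MEMBER OF THE SECT.-B STEP OF RECORD IN PRINT's READING (R13-U1), G′ SIDE: the letters-level frame
# `H2Frame₃` (the (vi′)-half of `B9SectBGpStepAtLettersV2.E4H2Frame₂`), its step theorem, the family `KSC₇ := {KSC with h1, e4, h2 := KSCU's}`,
# ★★ `h2_transfer_KSC₇` (the transfer field PROVED at def-Y's letters), ★★ `h2Frame₃CodedOn`, ★★ `stepH2Pos_KSC₇_on`, ★★ `stepH2Pos_KSCU_on` (pub-ymgap N06 row 13)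

T. Bałaban, *Propagators for lattice gauge theories in a background field*, Commun. Math. Phys. **99** (1985) 389–434
[`Balaban1985BackgroundPropagators`, "B9"]; [4] = T. Bałaban, *Propagators and renormalization transformations for lattice gauge
theories. II*, Commun. Math. Phys. **96** (1984) 223–250 [`Balaban1984PropagatorsII`].

statement-level skeleton of published theorems with citation tags; proofs where landed; nothing here is a claim about the
Yang–Mills mass gap

THE PRINTED LOCI.  Theorem 3.4 p. 400; (3.45) p. 398 (`‖ζ∇_UG′(U)∇*_Uλ‖_β ≦ B′₀(ε,β)(Lʲη)^{−β}(‖ζ‖_β + |ζ|)e^{−δ₀d(y,y′)}(‖λ‖_{β+ε} + |λ|)`); (3.43)–(3.44) p. 398;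
(3.40) p. 397; p. 403 l. 2–5; (3.3) p. 390, (3.8) p. 392 with (3.5) p. 391; (3.60)–(3.65) pp. 402–403; [4] (2.51)–(2.52) p. 232, Lemma 2.1 p. 234.

WHY THIS FILE (seat dag-n06-c gen 12; R13-U1).  r06's per-probe transfer (vi′) of `B9Thm34HolderGpUniformR1.thm34_Gp_holderInput_uniform` — the (3.45)-type
Hölder probe of `D_l·G′(U′U)·D_s` from the (3.42)₂∕₃ majorants, the LEFT Hölder probes of `D_l·G′(U)` at block-supported inputs, the sup data `N` of
`∇♯_k·G′(U)·D_s` and the probe `N₂` of the unperturbed word — is the second half of `E4H2Frame₂`; §1 separates it (`H2Frame₃`, output `H2Block`, writing function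
`wH2 B δc Bβ Bε Bεβ` — the (3.44) input constant `Bε` enters through `N`).  §2 is the family `KSC₇` (g7's augmented `KSC` with ALL THREE Hölder∕input members of
`B9SectBCodedReadingsU.KSCU`: the frame's input block `Ineq343_345` must be read in U-letters).  §3: the (3.45) member is the sup of `hqS` of the words
`ζ·∇_{U,μ}G′(dec c)∇*_{U,ν}(f ⊗ E)` = the NORMS OF THE PAIR PROBES `probeH` (`B9SectBH1ProbesY`) of `−coord⁻¹((D_l·G′·D_s)(coord(f ⊗ E)))`
(`symm_gradF_G_negGradB_eq`); the left premise is READ from the (3.43) block at the base (`quotL_blockSupp_le`), `N` from the (3.44) block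
(`B9SectBE4FrameCodedY.e4_read` + the neighbour identity), `N₂` from the (3.45) block (`h2_read`); the output is WRITTEN by `Real.iSup_le` ∕ `hqS_le_of_forall`;
`‖f‖_ε ≦ ‖f‖_{β+ε} + 2|f|` (`B9Ineq344LocalPairHolds.hqTP_mono_add`).  §4 the instance and the steps; ★★ `stepH2Pos_KSCU_on` has exactly the binders of
`B9SectBStepsKSCUBlocks.stepEPos_KSCU_on` (no new displayed law).
HONEST SCOPE.  Kernel bookkeeping: r06's R1 theorem CALLED, def-Y's letters READ and WRITTEN; nothing of [B9] asserted beyond the landed modules; COUNT-NEUTRAL;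
N06 NOT discharged; one finite lattice programme at fixed ε — nothing continuum, nothing about OS positivity or the mass gap.
-/

noncomputable section

namespace Literature.MathematicalPhysics.QuantumFieldTheory.Balaban1983to89.B9SectBH2FrameCodedY

open B6RandomWalk (HasMajorant hasMajorant_mono BlockSupp)
open B6KLevelCensusIndexV1 (KIdx kGeo)
open B6Ineq2142KLevelV1 (β)
open B6Prop22KLevelTorusCensusEta (nKT nKT_pos hqTP hqTP_nonneg)
open B9Thm34Ext (toB6)
open B9FromB6 (EBlock H1Block E4Block H2Block)
open B9Eq352DivFormLetters (conj coordEquiv gradLetterF gradLetterB gradLetterF_apply)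
open B9Eq352GradLetters (diffLetter diffLetter_inl diffLetter_inr)
open B9Thm34SectBUniformR1 (thm34_Gp_uniform)
open B9Thm34HolderGpUniformR1 (thm34_Gp_holderInput_uniform)
open B9SectBGpStepAtLettersV2 (GpFrame₂)
open B9SectBStepWhole (StepPos StepH2Pos)
open B9SectBCodedCarrier (CCfg Coding pullK pullS)
open B9Eq360DeltaPrimeAY (AfldY blkY)
open B9PinMembersKLevelV1 (MemberY geo9Y bg9Y)
open B9SectBGpLettersY (GVal decY coordC blkC GopC letters_base_of_gVal norm_le_one_and_inv_of_mem stencilB_blkC)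
open B9SectBGpFrameCodedY (codingYx CplxLettersY Read342Y Write342Y)
open B9SectBGpReadingsY (KSC baseY etaS_eq_eta read342Y_KSC write342Y_KSC)
open B9SectBCodedReadingsU (KSCU KACU)
open B9SectBStepsKSCU (KACU_members_base ineq342_346_347_congr thms_KSCU_base_iff hin_KSCU_on_pos)
open B9SectBGpTransferInY (ineq343_345_congr)
open B9SectBCodedChainOnSubfamily (gpFrame₂CodedOn)
open B9SectBStepPosFamilyTransfer (stepH2Pos_of_family_pos)
open B9GeoLemma21KLevelV1 (geo9Y_dist_triangle geo9Y_len_pos geo9Y_dist_comm)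
open B9RWSums347DefiniteFacesWindow (geo9Y_dist_nonneg)
open B9GeoNormsKLevelModelSignsV1 (modelSignsOn_geo9K)
open Node00 (SiteY BlkY IBondY CfgY BallY SiteParY BondParY BondOpY liftY deltaPrimeAY kernelFamilyS GpY UboxY shiftY etaS cdS cdsS cdS_smul hqS
  supBlkS' toKT)
open Node00.OpsYHolderFar (denS denS_nonneg pair_le_hqS hqS_le_of_forall hqS_nonneg)
open Node00.OpsYRead342 (geo9K_len_congr geo9K_dist_congr)
open Node00.OpsYRead342Cross (norm_cdsS_le_norm_cdS_symm_shift)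
open B9Ineq349SiteComposite (cdSL cdsSL cdSL_apply cdsSL_apply etaS_pos)
open B9Ineq344LocalPairHolds (hqTP_mono_add)
open B9SectBH1ReadWriteY (wordS quotS h1ReadT quotS_nonneg quotS_liftY_le)
open B9SectBH1ProbesY (probeH probeH_apply norm_probeH quotS_wordS_eq Gsc symm_conj_apply symm_gradF_G symm_G_negGradB cutH_inl_nonneg
  quotL_blockSupp_le norm_coordEquiv_symm_apply_le blockSupp_coordEquiv_liftY)
open B9SectBH1FrameCodedY (KSC₅ KSC₅_h1_inl len_blkC_eq pow_level_mul_etaS_le_one)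
open B9SectBE4FrameCodedY (KSC₆ abs_apply_le_norm_symm norm_symm_gradF_G_negGradB norm_symm_negGradB_G_negGradB e4_read)

/-! ## §1 The (3.45) frame: the (vi′)-half of `E4H2Frame₂` -/

section Frame

universe u

variable {I : Type} (d : ℕ) (c35 : ℝ) (geo : I → B9.Geometry) (bg : I → B9.Backgrounds)
  (Gp : ∀ i, B9.KernelFamily (geo i) (bg i))
  {𝔸 : Type u} [NormedRing 𝔸] [NormedAlgebra ℂ 𝔸] [CompleteSpace 𝔸] {ι : Type} [Fintype ι] [DecidableEq ι]
  (b : Module.Basis ι ℝ 𝔸) (κ : Type) [Fintype κ]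
  (S : I → Type) [∀ i, Fintype (S i)] [∀ i, DecidableEq (S i)]
  [∀ i, Fintype (geo i).Site] [∀ i, DecidableEq (geo i).Site] [∀ i, Nonempty (geo i).Site]

/-- **THE LETTERS DICTIONARY FOR THE (3.45) BLOCK OF G′, V3** — `GpFrame₂` plus the transfer field for the Hölder entry (3.45) ALONE: given the (3.42) block and the
whole Hölder block (3.43)–(3.45) of the family at U and r06's per-probe transfer (vi′) for the family's own `G′(U′U)` (verbatim the (vi′) hypothesis of
`E4H2Frame₂.e4h2_transfer`), the (3.45) block of the family holds at U′U with `(wH2 B δc Bβ Bε Bεβ, wH2δ δc)`.  A hypothesis structure; nothing asserted.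
[cite: Balaban1985BackgroundPropagators, (3.45) p.398, Thm 3.4 p.400, p.403 l.2–5, (3.65) p.402; Balaban1984PropagatorsII, (2.51)–(2.52) p.232, Lemma 2.1 p.234] -/
structure H2Frame₃ extends GpFrame₂ c35 geo bg Gp b κ S where
  wH2 : ℝ → ℝ → (ℝ → ℝ) → (ℝ → ℝ) → (ℝ → ℝ → ℝ) → (ℝ → ℝ → ℝ)
  wH2δ : ℝ → ℝ
  wH2δ_pos : ∀ δ : ℝ, 0 < δ → 0 < wH2δ δ
  /-- THE TRANSFER: r06's per-probe (vi′) (inputs at rate δc ≦ δ, outputs at 4δc∕5) for `G′(U′U)` ⇒ the (3.45) block at U′U, given the (3.42) block and the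
  Hölder block (3.43)–(3.45) at U at rate δ. -/
  h2_transfer : ∀ i (α₀ : ℝ) (U U' : (bg i).Cfg) (α₁ B₀ B δ δc : ℝ) (Bβ Bε : ℝ → ℝ) (Bεβ : ℝ → ℝ → ℝ),
    MInv ≤ (geo i).M → 0 < α₀ → (geo i).M * α₀ ≤ aInv → (bg i).Reg335 c35 α₀ U →
    0 < α₁ → α₁ ≤ aW → (bg i).Cplx337 α₁ U U' → 0 < B₀ → 0 ≤ B → 0 < δ → 0 < δc → δc ≤ δ →
    EBlock (Gp i) B₀ δ U → B9.Ineq343_345 (Gp i) Bβ Bε Bεβ δ U →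
    (∀ (Dl Ds : Module.End ℝ (S i × ι → ℝ)),
      HasMajorant (g := toB6 (geo i) (Rr i) (Hp i)) (fun p : S i × ι => blk i p.1) (Dl * Gop i U)
        (fun a a' => cR * B₀ * (geo i).len a * Real.exp (-(δc * (geo i).dist a a'))) →
      HasMajorant (g := toB6 (geo i) (Rr i) (Hp i)) (fun p : S i × ι => blk i p.1) (Gop i U * Ds)
        (fun a a' => cR * B₀ * (geo i).len a * Real.exp (-(δc * (geo i).dist a a'))) →
      ∀ (Φ : (S i → 𝔸) →ₗ[ℝ] 𝔸) (y : (geo i).Site) (p₀ : S i × ι), blk i p₀.1 = y →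
      ∀ (γ Bh cζ : ℝ), 0 ≤ Bh → 0 ≤ cζ →
        (∀ (y'' : (geo i).Site) (ν : S i × ι → ℝ) (C : ℝ),
          B6RandomWalk.BlockSupp (g := toB6 (geo i) (Rr i) (Hp i)) (fun p : S i × ι => blk i p.1) ν y'' C →
          ‖Φ ((B9Eq352DivFormLetters.coordEquiv b).symm (Dl (Gop i U ν)))‖ ≤
            Bh * (geo i).len y ^ (1 - γ) * cζ * Real.exp (-(δc * (geo i).dist y y'')) * C) →
      ∀ (y' : (geo i).Site) (μ : S i × ι → ℝ) (M : ℝ),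
        B6RandomWalk.BlockSupp (g := toB6 (geo i) (Rr i) (Hp i)) (fun p : S i × ι => blk i p.1) μ y' M →
      ∀ (N : ℝ), 0 ≤ N →
        (∀ (k : κ ⊕ κ) (z : S i × ι),
          |(((conj b (diffLetter (T i) (coord i U) ((((geo i).eta : ℂ))⁻¹) k)) * Gop i U * Ds) μ) z| ≤
            N * Real.exp (-(δc * (geo i).dist (blk i z.1) y'))) →
      ∀ (N₂ : ℝ), 0 ≤ N₂ →
        ‖Φ ((B9Eq352DivFormLetters.coordEquiv b).symm ((Dl * Gop i U * Ds) μ))‖ ≤ N₂ * Real.exp (-(δc * (geo i).dist y y')) →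
        ‖Φ ((B9Eq352DivFormLetters.coordEquiv b).symm ((Dl * Gop i ((bg i).mul U' U) * Ds) μ))‖ ≤
          B * (N₂ + Bh * (geo i).len y ^ (1 - γ) * cζ * ((geo i).len y)⁻¹ * (N + M)) *
            Real.exp (-(4 / 5 * δc * (geo i).dist y y'))) →
    B9FromB6.H2Block (Gp i) (wH2 B δc Bβ Bε Bεβ) (wH2δ δc) ((bg i).mul U' U)

variable {d c35 geo bg Gp b κ S}

/-- ★ **THE (3.45)-STEP OF SECT. B FOR G′(U′U), INHABITED AT THE LETTERS (V3)**: every `H2Frame₃` inhabits `StepH2Pos d c35 geo bg Gp GA Cinv Gp` (output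
`(wH2 B δr Bβ Bε Bεβ, wH2δ δr)`, δr = `rate δ₀`).  Proof = the (vi′)-half of V2's `stepE4H2Pos_of_e4h2Frame₂`.
[cite: Balaban1985BackgroundPropagators, Thm 3.4 p.400 + (3.45) p.398 + p.403 l.2–5; Balaban1984PropagatorsII, Lemma 2.1 p.234] -/
theorem stepH2Pos_of_h2Frame₃ (F : H2Frame₃ c35 geo bg Gp b κ S)
    (GA : ∀ i, B9.KernelFamily (geo i) (bg i)) (Cinv : ∀ i, B9.SiteKernel (geo i) (bg i)) :
    StepH2Pos d c35 geo bg Gp GA Cinv Gp := by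
  intro B₀ δ₀ Bβ Bε Bεβ B₁ δ₁ hB₀ hδ₀ _ _
  have hBG : 0 < F.cR * B₀ := mul_pos F.cR_pos hB₀
  have hδr : 0 < F.rate δ₀ := F.rate_pos hδ₀
  obtain ⟨a₁, ha₁, B, hB, H⟩ := thm34_Gp_holderInput_uniform b κ (F.d261 (F.rate δ₀)) (F.rate δ₀) (F.cR * B₀) F.Cq F.a₀
    F.d₀ F.M₂ (F.Λf (F.rate δ₀)) hBG F.Cq_nonneg F.a₀_nonneg F.M₂_nonneg hδr (fun α hα => F.Λf_one_le _ α hδr hα) F.hrepr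
  refine ⟨F.Mthr (F.rate δ₀), min a₁ F.aW, F.aInv, (F.wH2 B (F.rate δ₀) Bβ Bε Bεβ, F.wH2δ (F.rate δ₀)), F.Mthr_pos _,
    lt_min ha₁ F.aW_pos, F.aInv_pos, F.wH2δ_pos _ hδr, ?_⟩
  intro i hM0 α₀ hα₀ hMa U hU hT α₁ hα₁ ha U' hU'
  have hM : F.MInv ≤ (geo i).M := F.MInv_le_of_Mthr_le hM0
  obtain ⟨hΔG, hGΔ⟩ := F.reg_inv i α₀ U hM hα₀ hMa hU
  obtain ⟨h1, h2, h3, -⟩ := F.read342_le i α₀ U hM hα₀ hMa hU hB₀ hδ₀ (F.rate_le δ₀) hT.1.1.1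
  obtain ⟨hkF, hsF, h337s, h337F, h337B, hA, hAτ⟩ := F.cplx i α₁ U U' hα₁ hU'
  obtain ⟨hinv1, hinv2, -, hvi⟩ := H (F.T i) (F.coord i U) (F.blk i) (F.kQ i U) (F.sQ i U) (F.cfun i) (F.w i U)
    (F.dist_nonneg i) (F.triangle i) (F.dist_self i) (F.dist_comm i) (F.len_pos i) (F.eta_le_len i) (F.eta_pos i)
    (F.h261_of i hδr (F.rate_le_cap δ₀) hM0) (F.hST_of i hδr (F.rate_le_cap δ₀) hM0) (F.unitary i U)
    (F.stencilB i) (F.stencilF i) (F.stencil0 i) (F.w_nonneg i U) (F.card_w i U) (F.hkQ i U) (F.hsQ i U) (F.hcfun i)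
    hΔG hGΔ h1 h2 h3 α₁ hα₁.le (le_trans ha (min_le_left _ _)) (F.expA i U U') (F.kF i U U') (F.sF i U U')
    hkF hsF h337s h337F h337B hA hAτ
  have hG := F.gop_eq i ((bg i).mul U' U) _ _ (F.mul_law i α₁ U U' hα₁ hU') hinv1 hinv2
  rw [← hG] at hvi
  exact F.h2_transfer i α₀ U U' α₁ B₀ B δ₀ (F.rate δ₀) Bβ Bε Bεβ hM hα₀ hMa hU hα₁ (le_trans ha (min_le_right _ _)) hU'
    hB₀ hB hδ₀ hδr (F.rate_le δ₀) hT.1.1.1 hT.1.2 hvi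

end Frame

/-! ## §2 The family `KSC₇` (augmented (3.42) reading, ALL Hölder∕input members in U-letters) and its dictionaries -/

variable {d ℓ : ℕ} {hd : 1 ≤ d + 1} {hL : Odd (ℓ + 1) ∧ 1 < ℓ + 1} {b₀ b₁ : ℝ} {Mstar : ℕ}
variable {𝔸 : Type} [NormedRing 𝔸] [NormedAlgebra ℂ 𝔸] [CompleteSpace 𝔸] [FiniteDimensional ℝ 𝔸]

section Family

variable (G : Subgroup 𝔸ˣ) (x : MemberY d ℓ hd hL b₀ b₁ Mstar) (par : SiteParY 𝔸 x.toKIdx) {ι : Type} [Fintype ι] (b : Module.Basis ι ℝ 𝔸)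
  (ιB : BlkY x.toKIdx → IBondY x.toKIdx) (C37 C38 : ℝ → CfgY 𝔸 x.toKIdx → AfldY 𝔸 x.toKIdx → Prop)

/-- ★ **`KSC₇`** — g7's augmented coded reading `KSC` with the (3.43), (3.44), (3.45) members REPLACED by the U-letter ones of `KSCU`.
[cite: Balaban1985BackgroundPropagators, (3.42)–(3.45) pp.397–398, Thm 3.4 p.400, p.403 l.2–7] -/
def KSC₇ : B9.KernelFamily (geo9Y x) (codingYx G x C37 C38).bg :=
  { KSC G x par C37 C38 with h1 := (KSCU G x par C37 C38).h1, e4 := (KSCU G x par C37 C38).e4, h2 := (KSCU G x par C37 C38).h2 }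

omit [FiniteDimensional ℝ 𝔸] in
/-- the members of `KSC₇` (`rfl` ×4). [cite: Balaban1985BackgroundPropagators, (3.42)–(3.45) pp.397–398, bookkeeping] -/
theorem KSC₇_members :
    (KSC₇ G x par C37 C38).e = (KSC G x par C37 C38).e ∧ (KSC₇ G x par C37 C38).h1 = (KSCU G x par C37 C38).h1 ∧
      (KSC₇ G x par C37 C38).e4 = (KSCU G x par C37 C38).e4 ∧ (KSC₇ G x par C37 C38).h2 = (KSCU G x par C37 C38).h2 :=
  ⟨rfl, rfl, rfl, rfl⟩

omit [FiniteDimensional ℝ 𝔸] in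
/-- the (3.45) member of `KSC₇` on (site argument, site cut-off): `sup_E sup_{μ,ν} hqS (par U) α (ζ·∇_{U,μ}G′(dec c)∇*_{U,ν}(f ⊗ E))`, `U = base c` (`rfl`).
[cite: Balaban1985BackgroundPropagators, (3.45) p.398, (3.40) p.397, p.403 l.2–7, bookkeeping] -/
theorem KSC₇_h2_inl (c : (codingYx G x C37 C38).bg.Cfg) (f : SiteY x.toKIdx → ℝ) (α : ℝ) (z : SiteY x.toKIdx → ℝ) :
    (KSC₇ G x par C37 C38).h2 c (.inl f) α (.inl z) =
      ⨆ E : BallY 𝔸, ⨆ μ : Fin (d + 1), ⨆ ν : Fin (d + 1), hqS x.toKIdx (par (baseY x.toKIdx c)) α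
        (fun w => ((z w : ℝ) : ℂ) • cdS x.toKIdx (baseY x.toKIdx c) μ
          (GpY x.toKIdx par (decY x.toKIdx c) (cdsS x.toKIdx (baseY x.toKIdx c) ν (liftY f (E : 𝔸)))) w) := rfl

omit [FiniteDimensional ℝ 𝔸] in
/-- the (3.45) member of `KSC₇` vanishes off the (site argument, site cut-off) sector. [cite: Balaban1985BackgroundPropagators, (3.45) p.398, bookkeeping] -/
theorem KSC₇_h2_off (c : (codingYx G x C37 C38).bg.Cfg) (α : ℝ) :
    (∀ (f : SiteY x.toKIdx → ℝ) (zb : Node00.FBondY x.toKIdx → ℝ), (KSC₇ G x par C37 C38).h2 c (.inl f) α (.inr zb) = 0) ∧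
    (∀ (J : Node00.FBondY x.toKIdx → ℝ) (ζ : (geo9Y x).Cut), (KSC₇ G x par C37 C38).h2 c (.inr J) α ζ = 0) := by
  refine ⟨fun f zb => rfl, fun J ζ => ?_⟩
  rcases ζ with z | z <;> rfl

omit [FiniteDimensional ℝ 𝔸] in
/-- the (3.42) block of `KSC₇` IS that of `KSC`. [cite: Balaban1985BackgroundPropagators, (3.42) p.397, bookkeeping] -/
theorem eBlock_KSC₇_iff {B₀ δ : ℝ} (c : (codingYx G x C37 C38).bg.Cfg) :
    EBlock (KSC₇ G x par C37 C38) B₀ δ c ↔ EBlock (KSC G x par C37 C38) B₀ δ c := by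
  rw [EBlock, EBlock, (KSC₇_members G x par C37 C38).1]

omit [FiniteDimensional ℝ 𝔸] in
/-- the (3.43) block of `KSC₇` IS that of `KSC₅` (both = `KSCU`'s). [cite: Balaban1985BackgroundPropagators, (3.43) p.398, bookkeeping] -/
theorem h1Block_KSC₇_iff {Bβ : ℝ → ℝ} {δ : ℝ} (c : (codingYx G x C37 C38).bg.Cfg) :
    H1Block (KSC₇ G x par C37 C38) Bβ δ c ↔ H1Block (KSC₅ G x par C37 C38) Bβ δ c := by
  rw [H1Block, H1Block, (KSC₇_members G x par C37 C38).2.1, B9SectBH1FrameCodedY.KSC₅_h1]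

omit [FiniteDimensional ℝ 𝔸] in
/-- the (3.44) block of `KSC₇` IS that of `KSCU`. [cite: Balaban1985BackgroundPropagators, (3.44) p.398, bookkeeping] -/
theorem e4Block_KSC₇_iff {Bε : ℝ → ℝ} {δ : ℝ} (c : (codingYx G x C37 C38).bg.Cfg) :
    E4Block (KSC₇ G x par C37 C38) Bε δ c ↔ E4Block (KSCU G x par C37 C38) Bε δ c := by
  rw [E4Block, E4Block, (KSC₇_members G x par C37 C38).2.2.1]

omit [FiniteDimensional ℝ 𝔸] in
/-- the (3.45) block of `KSC₇` IS that of `KSCU`. [cite: Balaban1985BackgroundPropagators, (3.45) p.398, bookkeeping] -/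
theorem h2Block_KSC₇_iff {Bεβ : ℝ → ℝ → ℝ} {δ : ℝ} (c : (codingYx G x C37 C38).bg.Cfg) :
    H2Block (KSC₇ G x par C37 C38) Bεβ δ c ↔ H2Block (KSCU G x par C37 C38) Bεβ δ c := by
  rw [H2Block, H2Block, (KSC₇_members G x par C37 C38).2.2.2]

omit [FiniteDimensional ℝ 𝔸] in
/-- at a BASE configuration every member of `KSC₇` is `KSC`'s. [cite: Balaban1985BackgroundPropagators, (3.42)–(3.47) pp.397–398, bookkeeping] -/
theorem KSC₇_members_base (U : CfgY 𝔸 x.toKIdx) :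
    (∀ n, (KSC₇ G x par C37 C38).e n (.base U) = (KSC G x par C37 C38).e n (.base U)) ∧
    (KSC₇ G x par C37 C38).h1 (.base U) = (KSC G x par C37 C38).h1 (.base U) ∧
    (KSC₇ G x par C37 C38).e4 (.base U) = (KSC G x par C37 C38).e4 (.base U) ∧
    (KSC₇ G x par C37 C38).h2 (.base U) = (KSC G x par C37 C38).h2 (.base U) ∧
    (∀ n, (KSC₇ G x par C37 C38).l2 n (.base U) = (KSC G x par C37 C38).l2 n (.base U)) ∧
    (∀ n, (KSC₇ G x par C37 C38).glob n (.base U) = (KSC G x par C37 C38).glob n (.base U)) := by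
  refine ⟨fun _ => rfl, ?_, ?_, ?_, fun _ => rfl, fun _ => rfl⟩
  · funext lam α ζ
    rcases lam with f | J <;> rcases ζ with z | z <;> rfl
  · funext lam bb
    rcases lam with f | J <;> rfl
  · funext lam α ζ
    rcases lam with f | J <;> rcases ζ with z | z <;> rfl

variable [Fintype (geo9Y x).Site]

/-- the (3.42) reading dictionary of `KSC₇` is `KSC`'s. [cite: Balaban1985BackgroundPropagators, (3.42) p.397; Balaban1984PropagatorsII, (2.51) p.232] -/
theorem read342Y_KSC₇ (hι : ∀ s : BlkY x.toKIdx, β x.toKIdx.hN x.toKIdx.D x.toKIdx.hk (ιB s) = s)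
    (M₂ : ℝ) (hM₂ : 0 ≤ M₂) (hrepr : ∀ (v : 𝔸) (j : ι), |b.repr v j| ≤ M₂ * ‖v‖) (c35 MInv aInv : ℝ) :
    Read342Y G x par b ιB C37 C38 (KSC₇ G x par C37 C38) c35 (M₂ * ∑ j, ‖b j‖) MInv aInv 0 True :=
  fun α₀ U B₀ δ hM hα₀ hMa hreg hB₀ hδ hE =>
    read342Y_KSC G x par b ιB C37 C38 hι M₂ hM₂ hrepr c35 MInv aInv α₀ U B₀ δ hM hα₀ hMa hreg hB₀ hδ ((eBlock_KSC₇_iff G x par C37 C38 _).1 hE)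

omit [FiniteDimensional ℝ 𝔸] in
/-- the (3.42) writing dictionary of `KSC₇` is `KSC`'s. [cite: Balaban1985BackgroundPropagators, (3.42) p.397, p.403; Balaban1984PropagatorsII, (2.51) p.232] -/
theorem write342Y_KSC₇ (hι : ∀ s : BlkY x.toKIdx, β x.toKIdx.hN x.toKIdx.D x.toKIdx.hk (ιB s) = s)
    (M₂ : ℝ) (hM₂ : 0 ≤ M₂) (hrepr : ∀ (v : 𝔸) (j : ι), |b.repr v j| ≤ M₂ * ‖v‖) (aW : ℝ) (hC37 : ∀ β' U a, C37 β' U a → GVal G x.toKIdx U) :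
    Write342Y G x par b ιB C37 C38 (KSC₇ G x par C37 C38) (fun B _ => (M₂ * ∑ j, ‖b j‖) * B + 1) (fun δ => δ) aW 0 True :=
  fun U a α₁ B δ hα₁ hα₁W h37 hB hδ hG hDG hGD hLG =>
    (eBlock_KSC₇_iff G x par C37 C38 _).2 (write342Y_KSC G x par b ιB C37 C38 hι M₂ hM₂ hrepr aW hC37 U a α₁ B δ hα₁ hα₁W h37 hB hδ hG hDG hGD hLG)

end Family

/-! ## §3 Tools: the (3.45) word as a `wordS`, the value identity of the triple letter product, the (3.45) block READ -/

section Tools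

variable [NormOneClass 𝔸] (c35 : ℝ) (G : Subgroup 𝔸ˣ) (x : MemberY d ℓ hd hL b₀ b₁ Mstar) (par : SiteParY 𝔸 x.toKIdx) {ι : Type} [Fintype ι]
  (b : Module.Basis ι ℝ 𝔸) (ιB : BlkY x.toKIdx → IBondY x.toKIdx) [Fintype (geo9Y x).Site]
  (C37 C38 : ℝ → CfgY 𝔸 x.toKIdx → AfldY 𝔸 x.toKIdx → Prop)

/-- the (3.45) word-operator of `T` between the letters `∇_{U,μ}`, `∇*_{U,ν}` with the compensating `η⁻¹` (the `wordS` of `B9SectBH1ReadWriteY` carries an `η`).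
[cite: Balaban1985BackgroundPropagators, (3.45) p.398, bookkeeping] -/
abbrev W2 (T : (SiteY x.toKIdx → 𝔸) →ₗ[ℂ] (SiteY x.toKIdx → 𝔸)) (U : CfgY 𝔸 x.toKIdx) (μ ν : Fin (d + 1)) :
    (SiteY x.toKIdx → 𝔸) →ₗ[ℂ] (SiteY x.toKIdx → 𝔸) :=
  ((((etaS x.toKIdx : ℝ) : ℂ))⁻¹) • (cdSL x.toKIdx U μ ∘ₗ T ∘ₗ cdsSL x.toKIdx U ν)

omit [FiniteDimensional ℝ 𝔸] [NormOneClass 𝔸] [Fintype (geo9Y x).Site] in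
/-- ★ the (3.45) integrand is the `wordS` of `W2`: `ζ·∇_{U,μ}T∇*_{U,ν}Λ = wordS ζ (W2 T U μ ν) Λ`. [cite: Balaban1985BackgroundPropagators, (3.45) p.398, bookkeeping] -/
theorem h2word_eq (T : (SiteY x.toKIdx → 𝔸) →ₗ[ℂ] (SiteY x.toKIdx → 𝔸)) (U : CfgY 𝔸 x.toKIdx) (μ ν : Fin (d + 1)) (ζ : SiteY x.toKIdx → ℝ)
    (Λ : SiteY x.toKIdx → 𝔸) :
    (fun w => ((ζ w : ℝ) : ℂ) • cdS x.toKIdx U μ (T (cdsS x.toKIdx U ν Λ)) w) = wordS x.toKIdx ζ (W2 x T U μ ν) Λ := by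
  have hη : ((etaS x.toKIdx : ℝ) : ℂ) ≠ 0 := by exact_mod_cast (etaS_pos x.toKIdx).ne'
  funext w
  simp only [wordS, W2, LinearMap.smul_apply, LinearMap.coe_comp, Function.comp_apply, cdSL_apply, cdsSL_apply, Pi.smul_apply, smul_smul]
  congr 1
  rw [Complex.ofReal_mul, mul_assoc, mul_inv_cancel₀ hη, mul_one]

omit [FiniteDimensional ℝ 𝔸] [NormOneClass 𝔸] [Fintype (geo9Y x).Site] in
/-- ★ **THE TRIPLE LETTER PRODUCT `D_l·(η²T)·D_s` READ BACK AS A FUNCTION** (forward letter on the left): `coord⁻¹((conj b(η⁻¹∇_μ) * conj b(η²T) * conj b(−η⁻¹∇*_ν)) v) =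
−∇_{U,μ}T∇*_{U,ν}(coord⁻¹v)`. [cite: Balaban1985BackgroundPropagators, (3.44)–(3.45) p.398, (3.3) p.390, (3.8) p.392; Balaban1984PropagatorsII, (2.51)–(2.52) p.232] -/
theorem symm_gradF_G_negGradB_eq (T : (SiteY x.toKIdx → 𝔸) →ₗ[ℂ] (SiteY x.toKIdx → 𝔸)) (U : CfgY 𝔸 x.toKIdx) (μ ν : Fin (d + 1))
    (v : SiteY x.toKIdx × ι → ℝ) :
    (coordEquiv b).symm ((conj b (gradLetterF (shiftY x.toKIdx) (UboxY x.toKIdx U) ((((etaS x.toKIdx : ℝ) : ℂ))⁻¹) μ) * conj b (Gsc x.toKIdx T) *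
        conj b (-gradLetterB (shiftY x.toKIdx) (UboxY x.toKIdx U) ((((etaS x.toKIdx : ℝ) : ℂ))⁻¹) ν)) v) =
      -(cdS x.toKIdx U μ (T (cdsS x.toKIdx U ν ((coordEquiv b).symm v)))) := by
  have hη : ((etaS x.toKIdx : ℝ) : ℂ) ≠ 0 := by exact_mod_cast (etaS_pos x.toKIdx).ne'
  rw [mul_assoc, Module.End.mul_apply, symm_conj_apply, symm_G_negGradB]
  funext w
  show ((((etaS x.toKIdx : ℝ) : ℂ))⁻¹) • B9Eq39Adjoint.covD (shiftY x.toKIdx) (UboxY x.toKIdx U) μ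
      (-((((etaS x.toKIdx : ℝ) : ℂ)) • T (cdsS x.toKIdx U ν ((coordEquiv b).symm v)))) w = _
  have h1 : cdS x.toKIdx U μ (-((((etaS x.toKIdx : ℝ) : ℂ)) • T (cdsS x.toKIdx U ν ((coordEquiv b).symm v)))) =
      -((((etaS x.toKIdx : ℝ) : ℂ)) • cdS x.toKIdx U μ (T (cdsS x.toKIdx U ν ((coordEquiv b).symm v)))) := by
    rw [← cdSL_apply, map_neg, map_smul, cdSL_apply]
  have h2 := congrFun h1 w
  change B9Eq39Adjoint.covD (shiftY x.toKIdx) (UboxY x.toKIdx U) μ _ w = _ at h2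
  rw [h2, Pi.neg_apply, Pi.smul_apply, smul_neg, smul_smul, inv_mul_cancel₀ hη, one_smul, Pi.neg_apply]

omit [CompleteSpace 𝔸] [FiniteDimensional ℝ 𝔸] [NormOneClass 𝔸] [Fintype (geo9Y x).Site] in
/-- a uniform bound of the (3.45) integrand's `hqS` over the unit ball: `hqS(word(f ⊗ E)) ≦ M₂·Σ_j hqS(word(f ⊗ b_j))` for `‖E‖ ≦ 1`.
[cite: Balaban1985BackgroundPropagators, (3.45) p.398 (sup over |λ| ≤ 1), bookkeeping] -/
theorem hqS_wordS_liftY_le (W : (SiteY x.toKIdx → 𝔸) →ₗ[ℂ] (SiteY x.toKIdx → 𝔸)) (p : SiteY x.toKIdx → SiteY x.toKIdx → 𝔸ˣ) (α : ℝ)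
    (ζ : SiteY x.toKIdx → ℝ) {M₂ : ℝ} (hM₂ : 0 ≤ M₂) (hrepr : ∀ (v : 𝔸) (j : ι), |b.repr v j| ≤ M₂ * ‖v‖) (f : SiteY x.toKIdx → ℝ)
    {E : 𝔸} (hE : ‖E‖ ≤ 1) :
    hqS x.toKIdx p α (wordS x.toKIdx ζ W (liftY f E)) ≤ M₂ * ∑ j, hqS x.toKIdx p α (wordS x.toKIdx ζ W (liftY f (b j))) := by
  have hS : 0 ≤ ∑ j, hqS x.toKIdx p α (wordS x.toKIdx ζ W (liftY f (b j))) := Finset.sum_nonneg fun j _ => hqS_nonneg x.toKIdx p α _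
  refine hqS_le_of_forall x.toKIdx p α _ (mul_nonneg hM₂ hS) fun z z' hne => ?_
  refine (quotS_liftY_le x.toKIdx b ζ W p α hrepr f E z z').trans ?_
  calc M₂ * ‖E‖ * ∑ j, quotS x.toKIdx p α (wordS x.toKIdx ζ W (liftY f (b j))) z z'
      ≤ M₂ * 1 * ∑ j, hqS x.toKIdx p α (wordS x.toKIdx ζ W (liftY f (b j))) := by
        refine mul_le_mul (mul_le_mul_of_nonneg_left hE hM₂) (Finset.sum_le_sum fun j _ => pair_le_hqS x.toKIdx p α _ hne)
          (Finset.sum_nonneg fun j _ => quotS_nonneg x.toKIdx p α _ z z') (mul_nonneg hM₂ zero_le_one)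
    _ = M₂ * ∑ j, hqS x.toKIdx p α (wordS x.toKIdx ζ W (liftY f (b j))) := by rw [mul_one]

omit [FiniteDimensional ℝ 𝔸] [NormOneClass 𝔸] [Fintype (geo9Y x).Site] in
/-- ★ **THE (3.45) BLOCK OF `KSCU` AT A BASE, READ AT A PAIR**: `quot_{z,z′}(ζ·∇_{U,μ}G′(U)∇*_{U,ν}(f ⊗ E)) ≦ B′₀(ε,β)·ℓ(y)^{−β}·(‖ζ‖_β + |ζ|)·e^{−δd(y,y′)}·
(‖f‖_{β+ε} + |f|)` for `supp ζ ⊂ Δ(βy)`, `supp f ⊂ Δ(βy′)`, `‖E‖ ≦ 1`, `z ≠ z′` (the pair is below `hqS`, which is below its `⨆` — bounded over the ball by the basis).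
[cite: Balaban1985BackgroundPropagators, (3.45) p.398, (3.40) p.397] -/
theorem h2_read {M₂ : ℝ} (hM₂ : 0 ≤ M₂) (hrepr : ∀ (v : 𝔸) (j : ι), |b.repr v j| ≤ M₂ * ‖v‖)
    {Bεβ : ℝ → ℝ → ℝ} {δ : ℝ} {U : CfgY 𝔸 x.toKIdx} (hH2 : H2Block (KSCU G x par C37 C38) Bεβ δ (.base U))
    {ε β' : ℝ} (hε0 : 0 < ε) (hε1 : ε ≤ 1) (hβ0 : 0 ≤ β') (hβ1 : β' < 1) (f : SiteY x.toKIdx → ℝ) (ζ : SiteY x.toKIdx → ℝ) (y y' : IBondY x.toKIdx)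
    (hζ : (geo9Y x).cutInT (Sum.inl ζ) y) (hs : (geo9Y x).suppIn (Sum.inl f) y') (E : BallY 𝔸) (μ ν : Fin (d + 1)) {z z' : SiteY x.toKIdx} (hne : z ≠ z') :
    quotS x.toKIdx (par U) β' (fun w => ((ζ w : ℝ) : ℂ) • cdS x.toKIdx U μ (GpY x.toKIdx par U (cdsS x.toKIdx U ν (liftY f (E : 𝔸)))) w) z z' ≤
      Bεβ ε β' * (geo9Y x).len y ^ (-β') * (geo9Y x).cutH β' (Sum.inl ζ) * Real.exp (-(δ * (geo9Y x).dist y y')) *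
        ((geo9Y x).holder (β' + ε) (Sum.inl f) + (geo9Y x).supNorm (Sum.inl f)) := by
  have h := hH2 ε β' (Sum.inl f) (Sum.inl ζ) y y' hε0 hε1 hβ0 hβ1 hζ hs
  have hK : (KSCU G x par C37 C38).h2 (.base U) (.inl f) β' (.inl ζ) =
      ⨆ E' : BallY 𝔸, ⨆ μ' : Fin (d + 1), ⨆ ν' : Fin (d + 1), hqS x.toKIdx (par U) β'
        (fun w => ((ζ w : ℝ) : ℂ) • cdS x.toKIdx U μ' (GpY x.toKIdx par U (cdsS x.toKIdx U ν' (liftY f (E' : 𝔸)))) w) := rfl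
  rw [hK] at h
  refine le_trans ?_ h
  set T : (SiteY x.toKIdx → 𝔸) →ₗ[ℂ] (SiteY x.toKIdx → 𝔸) := GpY x.toKIdx par U with hT
  -- every integrand is the `wordS` of `W2`; bounded over the unit ball
  have hw : ∀ (E' : 𝔸) (μ' ν' : Fin (d + 1)), (fun w => ((ζ w : ℝ) : ℂ) • cdS x.toKIdx U μ' (T (cdsS x.toKIdx U ν' (liftY f E'))) w) =
      wordS x.toKIdx ζ (W2 x T U μ' ν') (liftY f E') := fun E' μ' ν' => h2word_eq x T U μ' ν' ζ _
  have hbdd : BddAbove (Set.range fun E' : BallY 𝔸 => ⨆ μ' : Fin (d + 1), ⨆ ν' : Fin (d + 1), hqS x.toKIdx (par U) β'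
      (fun w => ((ζ w : ℝ) : ℂ) • cdS x.toKIdx U μ' (T (cdsS x.toKIdx U ν' (liftY f (E' : 𝔸)))) w)) := by
    refine ⟨∑ μ', ∑ ν', M₂ * ∑ j, hqS x.toKIdx (par U) β' (wordS x.toKIdx ζ (W2 x T U μ' ν') (liftY f (b j))), ?_⟩
    rintro _ ⟨E', rfl⟩
    have hnn : ∀ μ' ν', 0 ≤ M₂ * ∑ j, hqS x.toKIdx (par U) β' (wordS x.toKIdx ζ (W2 x T U μ' ν') (liftY f (b j))) := fun μ' ν' =>
      mul_nonneg hM₂ (Finset.sum_nonneg fun j _ => hqS_nonneg x.toKIdx _ β' _)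
    have hS : 0 ≤ ∑ μ', ∑ ν', M₂ * ∑ j, hqS x.toKIdx (par U) β' (wordS x.toKIdx ζ (W2 x T U μ' ν') (liftY f (b j))) :=
      Finset.sum_nonneg fun μ' _ => Finset.sum_nonneg fun ν' _ => hnn μ' ν'
    refine Real.iSup_le (fun μ' => Real.iSup_le (fun ν' => ?_) hS) hS
    rw [hw]
    refine (hqS_wordS_liftY_le x b (W2 x T U μ' ν') (par U) β' ζ hM₂ hrepr f (mem_closedBall_zero_iff.1 E'.2)).trans ?_
    refine le_trans ?_ (Finset.single_le_sum (f := fun μ'' => ∑ ν', M₂ * ∑ j, hqS x.toKIdx (par U) β' (wordS x.toKIdx ζ (W2 x T U μ'' ν') (liftY f (b j))))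
      (fun μ'' _ => Finset.sum_nonneg fun ν' _ => hnn μ'' ν') (Finset.mem_univ μ'))
    exact Finset.single_le_sum (f := fun ν'' => M₂ * ∑ j, hqS x.toKIdx (par U) β' (wordS x.toKIdx ζ (W2 x T U μ' ν'') (liftY f (b j))))
      (fun ν'' _ => hnn μ' ν'') (Finset.mem_univ ν')
  refine le_trans ?_ (le_ciSup hbdd E)
  refine le_trans ?_ (le_ciSup (f := fun μ' : Fin (d + 1) => ⨆ ν' : Fin (d + 1), hqS x.toKIdx (par U) β'
    (fun w => ((ζ w : ℝ) : ℂ) • cdS x.toKIdx U μ' (T (cdsS x.toKIdx U ν' (liftY f (E : 𝔸)))) w)) (Finite.bddAbove_range _) μ)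
  refine le_trans ?_ (le_ciSup (f := fun ν' : Fin (d + 1) => hqS x.toKIdx (par U) β'
    (fun w => ((ζ w : ℝ) : ℂ) • cdS x.toKIdx U μ (T (cdsS x.toKIdx U ν' (liftY f (E : 𝔸)))) w)) (Finite.bddAbove_range _) ν)
  exact pair_le_hqS x.toKIdx (par U) β' (fun w => ((ζ w : ℝ) : ℂ) • cdS x.toKIdx U μ (T (cdsS x.toKIdx U ν (liftY f (E : 𝔸)))) w) hne

end Tools

/-! ## §4 ★★ The transfer field PROVED for `KSC₇` -/

section Transfer

variable [NormOneClass 𝔸] (c35 : ℝ) (G : Subgroup 𝔸ˣ) (x : MemberY d ℓ hd hL b₀ b₁ Mstar) (par : SiteParY 𝔸 x.toKIdx) {ι : Type} [Fintype ι]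
  (b : Module.Basis ι ℝ 𝔸) (ιB : BlkY x.toKIdx → IBondY x.toKIdx) [Fintype (geo9Y x).Site]
  (C37 C38 : ℝ → CfgY 𝔸 x.toKIdx → AfldY 𝔸 x.toKIdx → Prop)

/-- the output writing function: `wH2 B δc Bβ Bε Bεβ ε β = B·(B⁺_{εβ} + 3·(Σ‖b_j‖)·B⁺_β·M₂·(B⁺_ε·e^{2(d+1)δc} + 1))`, `B⁺ = max · 0`.
[cite: Balaban1985BackgroundPropagators, (3.45) p.398, p.403 l.2–5 («of course with different constants»)] -/
def wH2₇ (dd Sb M₂ : ℝ) (B δc : ℝ) (Bβ Bε : ℝ → ℝ) (Bεβ : ℝ → ℝ → ℝ) : ℝ → ℝ → ℝ := fun ε β' =>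
  B * (max (Bεβ ε β') 0 + 3 * (Sb * max (Bβ β') 0) * M₂ * (max (Bε ε) 0 * Real.exp (δc * dd) + 1))

omit [NormedAlgebra ℂ 𝔸] [CompleteSpace 𝔸] [FiniteDimensional ℝ 𝔸] [NormOneClass 𝔸] in
/-- `0 ≤ wH2₇` for nonnegative data. [cite: Balaban1985BackgroundPropagators, (3.45) p.398, bookkeeping] -/
theorem wH2₇_nonneg {dd Sb M₂ B δc : ℝ} (Bβ Bε : ℝ → ℝ) (Bεβ : ℝ → ℝ → ℝ) (hSb : 0 ≤ Sb) (hB : 0 ≤ B) (hM₂ : 0 ≤ M₂) (ε β' : ℝ) :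
    0 ≤ wH2₇ dd Sb M₂ B δc Bβ Bε Bεβ ε β' := by
  unfold wH2₇
  have h0 : 0 ≤ max (Bεβ ε β') 0 := le_max_right _ _
  have h1 : 0 ≤ max (Bβ β') 0 := le_max_right _ _
  have h2 : 0 ≤ max (Bε ε) 0 := le_max_right _ _
  positivity

set_option maxHeartbeats 1600000 in
/-- ★★ **THE TRANSFER FIELD OF THE (3.45) FRAME, PROVED FOR `KSC₇` AT def-Y's LETTERS** (see the module header): from r06's per-probe transfer (vi′) for the letters of
the member (hypothesis `HVI`, the shape of `H2Frame₃.h2_transfer`), the (3.42) majorants at the base (`hread`), the Hölder block (3.43)–(3.45) of `KSC₇` at the base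
and unit norms of the bond variables and transporters (`G`-valued base): the (3.45) block of `KSC₇` at the coded product with `(wH2₇ … B δc Bβ Bε Bεβ, 4δc∕5)`.  For the
output word `ζ·∇_{U,μ}G′(U′U)∇*_{U,ν}(f ⊗ E)` and a pair `(z, z′)`: `Φ := probeH (par U) β ζ z z′`, `D_l := conj b(η⁻¹∇_μ)`, `D_s := conj b(−η⁻¹∇*_ν)`, anchor = the
labelled block of a point of `supp ζ`; the LEFT premise from the (3.43) block, `N` from the (3.44) block, `N₂` from the (3.45) block at the base.
[cite: Balaban1985BackgroundPropagators, Thm 3.4 p.400, (3.43)–(3.45) p.398, (3.40) p.397, p.403 l.2–7, (3.3) p.390, (3.8) p.392; Balaban1984PropagatorsII, (2.51)–(2.52) p.232, (2.54) p.233] -/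
theorem h2_transfer_KSC₇ (hι : ∀ s : BlkY x.toKIdx, β x.toKIdx.hN x.toKIdx.D x.toKIdx.hk (ιB s) = s)
    (hG1 : ∀ u : 𝔸ˣ, u ∈ G → ‖(u : 𝔸)‖ ≤ 1)
    {M₂ : ℝ} (hM₂ : 0 ≤ M₂) (hrepr : ∀ (v : 𝔸) (j : ι), |b.repr v j| ≤ M₂ * ‖v‖)
    {MInv cR aInv aW : ℝ} (hcR : 0 < cR) (hread : Read342Y G x par b ιB C37 C38 (KSC₇ G x par C37 C38) c35 cR MInv aInv 0 True)
    (α₀ : ℝ) (c c' : (codingYx G x C37 C38).bg.Cfg) (α₁ B₀ B δ δc : ℝ) (Bβ Bε : ℝ → ℝ) (Bεβ : ℝ → ℝ → ℝ)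
    (hM : MInv ≤ (geo9Y x).M) (hα₀ : 0 < α₀) (hMa : (geo9Y x).M * α₀ ≤ aInv) (hreg : (codingYx G x C37 C38).bg.Reg335 c35 α₀ c)
    (_hα₁ : 0 < α₁) (_haW : α₁ ≤ aW) (h37 : (codingYx G x C37 C38).bg.Cplx337 α₁ c c') (hB₀ : 0 < B₀) (hB : 0 ≤ B)
    (hδ : 0 < δ) (hδc : 0 < δc) (hδcδ : δc ≤ δ)
    (hE : EBlock (KSC₇ G x par C37 C38) B₀ δ c) (hHol : B9.Ineq343_345 (KSC₇ G x par C37 C38) Bβ Bε Bεβ δ c)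
    (HVI : ∀ (Dl Ds : Module.End ℝ (SiteY x.toKIdx × ι → ℝ)),
      HasMajorant (g := toB6 (geo9Y x) (0 : ℝ) True) (fun p : SiteY x.toKIdx × ι => blkC x.toKIdx ιB p.1) (Dl * GopC x.toKIdx par b c)
        (fun a a' => cR * B₀ * (geo9Y x).len a * Real.exp (-(δc * (geo9Y x).dist a a'))) →
      HasMajorant (g := toB6 (geo9Y x) (0 : ℝ) True) (fun p : SiteY x.toKIdx × ι => blkC x.toKIdx ιB p.1) (GopC x.toKIdx par b c * Ds)
        (fun a a' => cR * B₀ * (geo9Y x).len a * Real.exp (-(δc * (geo9Y x).dist a a'))) →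
      ∀ (Φ : (SiteY x.toKIdx → 𝔸) →ₗ[ℝ] 𝔸) (y : IBondY x.toKIdx) (p₀ : SiteY x.toKIdx × ι), blkC x.toKIdx ιB p₀.1 = y →
      ∀ (γ Bh cζ : ℝ), 0 ≤ Bh → 0 ≤ cζ →
        (∀ (y'' : IBondY x.toKIdx) (ν : SiteY x.toKIdx × ι → ℝ) (C : ℝ),
          BlockSupp (g := toB6 (geo9Y x) (0 : ℝ) True) (fun p : SiteY x.toKIdx × ι => blkC x.toKIdx ιB p.1) ν y'' C →
          ‖Φ ((coordEquiv b).symm (Dl (GopC x.toKIdx par b c ν)))‖ ≤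
            Bh * (geo9Y x).len y ^ (1 - γ) * cζ * Real.exp (-(δc * (geo9Y x).dist y y'')) * C) →
      ∀ (y' : IBondY x.toKIdx) (μ : SiteY x.toKIdx × ι → ℝ) (M : ℝ),
        BlockSupp (g := toB6 (geo9Y x) (0 : ℝ) True) (fun p : SiteY x.toKIdx × ι => blkC x.toKIdx ιB p.1) μ y' M →
      ∀ (N : ℝ), 0 ≤ N →
        (∀ (k : Fin (d + 1) ⊕ Fin (d + 1)) (z : SiteY x.toKIdx × ι),
          |(((conj b (diffLetter (shiftY x.toKIdx) (coordC G x.toKIdx c) ((((geo9Y x).eta : ℂ))⁻¹) k)) * GopC x.toKIdx par b c * Ds) μ) z| ≤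
            N * Real.exp (-(δc * (geo9Y x).dist (blkC x.toKIdx ιB z.1) y'))) →
      ∀ (N₂ : ℝ), 0 ≤ N₂ →
        ‖Φ ((coordEquiv b).symm ((Dl * GopC x.toKIdx par b c * Ds) μ))‖ ≤ N₂ * Real.exp (-(δc * (geo9Y x).dist y y')) →
        ‖Φ ((coordEquiv b).symm ((Dl * GopC x.toKIdx par b ((codingYx G x C37 C38).bg.mul c' c) * Ds) μ))‖ ≤
          B * (N₂ + Bh * (geo9Y x).len y ^ (1 - γ) * cζ * ((geo9Y x).len y)⁻¹ * (N + M)) *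
            Real.exp (-(4 / 5 * δc * (geo9Y x).dist y y'))) :
    H2Block (KSC₇ G x par C37 C38) (wH2₇ (2 * ((d : ℝ) + 1)) (∑ j, ‖b j‖) M₂ B δc Bβ Bε Bεβ) (4 / 5 * δc)
      ((codingYx G x C37 C38).bg.mul c' c) := by
  classical
  letI : Fintype (B9GeoNormsKLevelV1.geo9K x.toKIdx).Site := ‹Fintype (geo9Y x).Site›
  obtain ⟨U, a, rfl, rfl, hCa⟩ := (codingYx G x C37 C38).exists_of_bg_Cplx337 h37
  have hU335 : (bg9Y 𝔸 G x).Reg335 c35 α₀ U := by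
    obtain ⟨U', h1, h2⟩ := (codingYx G x C37 C38).exists_of_bg_Reg335 hreg
    cases h1
    exact h2
  have hU : GVal G x.toKIdx U := hU335.1.1
  set Sb : ℝ := ∑ j, ‖b j‖ with hSb
  have hSb0 : 0 ≤ Sb := Finset.sum_nonneg fun j _ => norm_nonneg _
  set TU : (SiteY x.toKIdx → 𝔸) →ₗ[ℂ] (SiteY x.toKIdx → 𝔸) := GpY x.toKIdx par U with hTU
  set TW : (SiteY x.toKIdx → 𝔸) →ₗ[ℂ] (SiteY x.toKIdx → 𝔸) := GpY x.toKIdx par (decY x.toKIdx (.prod U a)) with hTW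
  have hη : 0 < etaS x.toKIdx := etaS_pos x.toKIdx
  have hco : coordC G x.toKIdx (.base U) = UboxY x.toKIdx U := (letters_base_of_gVal G x.toKIdx par hU).1
  have hGopU : GopC x.toKIdx par b (.base U) = conj b (Gsc x.toKIdx TU) := by
    show conj b (((kGeo x.toKIdx).eta ^ 2) • (GpY x.toKIdx par U).restrictScalars ℝ) = conj b ((etaS x.toKIdx ^ 2) • TU.restrictScalars ℝ)
    rw [etaS_eq_eta]
  have hGopW : GopC x.toKIdx par b ((codingYx G x C37 C38).bg.mul (.mult a) (.base U)) = conj b (Gsc x.toKIdx TW) := by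
    show conj b (((kGeo x.toKIdx).eta ^ 2) • (GpY x.toKIdx par (decY x.toKIdx (.prod U a))).restrictScalars ℝ) =
      conj b ((etaS x.toKIdx ^ 2) • TW.restrictScalars ℝ)
    rw [etaS_eq_eta]
  have hDk : ∀ k : Fin (d + 1) ⊕ Fin (d + 1),
      diffLetter (shiftY x.toKIdx) (coordC G x.toKIdx (.base U)) ((((geo9Y x).eta : ℂ))⁻¹) k =
        diffLetter (shiftY x.toKIdx) (UboxY x.toKIdx U) ((((etaS x.toKIdx : ℝ) : ℂ))⁻¹) k := by
    intro k
    show diffLetter (shiftY x.toKIdx) (coordC G x.toKIdx (.base U)) ((((kGeo x.toKIdx).eta : ℝ) : ℂ))⁻¹ k = _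
    rw [hco, etaS_eq_eta]
  have hUu : ∀ (μ : Fin (d + 1)) (w : SiteY x.toKIdx), ‖((UboxY x.toKIdx U μ w : 𝔸ˣ) : 𝔸)‖ ≤ 1 ∧ ‖(((UboxY x.toKIdx U μ w)⁻¹ : 𝔸ˣ) : 𝔸)‖ ≤ 1 :=
    fun μ w => norm_le_one_and_inv_of_mem G hG1 (hU μ _)
  have hdd : 0 ≤ 2 * ((d : ℝ) + 1) := by positivity
  -- the (3.42) majorants of the letters at the base
  obtain ⟨-, hm1, hm2, -⟩ := hread α₀ U B₀ δ hM hα₀ hMa hU335 hB₀ hδ hE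
  have hlow : ∀ a a' : IBondY x.toKIdx, cR * B₀ * (geo9Y x).len a * Real.exp (-(δ * (geo9Y x).dist a a')) ≤
      cR * B₀ * (geo9Y x).len a * Real.exp (-(δc * (geo9Y x).dist a a')) := fun a a' =>
    mul_le_mul_of_nonneg_left (Real.exp_le_exp.2 (by nlinarith [geo9Y_dist_nonneg x a a'])) (mul_nonneg (mul_pos hcR hB₀).le (geo9Y_len_pos x a).le)
  -- the three Hölder∕input blocks at the base, in U-letters
  obtain ⟨hH1, hE4, hH2⟩ := hHol
  have hH1' : H1Block (KSC₅ G x par C37 C38) Bβ δ (.base U) := (h1Block_KSC₇_iff G x par C37 C38 _).1 hH1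
  have hE4' : E4Block (KSCU G x par C37 C38) Bε δ (.base U) := (e4Block_KSC₇_iff G x par C37 C38 _).1 hE4
  have hH2' : H2Block (KSCU G x par C37 C38) Bεβ δ (.base U) := (h2Block_KSC₇_iff G x par C37 C38 _).1 hH2
  -- the output block
  intro ε β' lam ζ y y' hε0 hε1 hβ0 hβ1 hζ hlam
  have hW : 0 ≤ wH2₇ (2 * ((d : ℝ) + 1)) Sb M₂ B δc Bβ Bε Bεβ ε β' := wH2₇_nonneg Bβ Bε Bεβ hSb0 hB hM₂ ε β'
  have hleny : 0 < (geo9Y x).len y := geo9Y_len_pos x y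
  have hcutH : 0 ≤ (geo9Y x).cutH β' ζ := (modelSignsOn_geo9K x.toKIdx).cutH_nonneg β' ζ
  have hHS : 0 ≤ (geo9Y x).holder (β' + ε) lam + (geo9Y x).supNorm lam :=
    add_nonneg ((modelSignsOn_geo9K x.toKIdx).holder_nonneg _ lam) ((modelSignsOn_geo9K x.toKIdx).supNorm_nonneg lam)
  have hRHS : 0 ≤ wH2₇ (2 * ((d : ℝ) + 1)) Sb M₂ B δc Bβ Bε Bεβ ε β' * (geo9Y x).len y ^ (-β') * (geo9Y x).cutH β' ζ *
      Real.exp (-(4 / 5 * δc * (geo9Y x).dist y y')) * ((geo9Y x).holder (β' + ε) lam + (geo9Y x).supNorm lam) :=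
    mul_nonneg (mul_nonneg (mul_nonneg (mul_nonneg hW (Real.rpow_nonneg hleny.le _)) hcutH) (Real.exp_pos _).le) hHS
  rcases lam with f | J
  swap
  · rw [(KSC₇_h2_off G x par C37 C38 _ β').2 J ζ]; exact hRHS
  rcases ζ with ζ₀ | zb
  swap
  · rw [(KSC₇_h2_off G x par C37 C38 _ β').1 f zb]; exact hRHS
  have hlam' : (geo9Y x).suppIn (Sum.inl f) y' := hlam
  have hζ' : ∀ w, ζ₀ w ≠ 0 → blkY x.toKIdx w = β x.toKIdx.hN x.toKIdx.D x.toKIdx.hk y := hζ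
  have hsupN : 0 ≤ (geo9Y x).supNorm (Sum.inl f) := (modelSignsOn_geo9K x.toKIdx).supNorm_nonneg _
  have hholε : 0 ≤ (geo9Y x).holder ε (Sum.inl f) := (modelSignsOn_geo9K x.toKIdx).holder_nonneg ε _
  have hhol : 0 ≤ (geo9Y x).holder (β' + ε) (Sum.inl f) := (modelSignsOn_geo9K x.toKIdx).holder_nonneg _ _
  -- `‖f‖_ε ≦ ‖f‖_{β+ε} + 2|f|`
  have hholmono : (geo9Y x).holder ε (Sum.inl f) ≤ (geo9Y x).holder (β' + ε) (Sum.inl f) + 2 * (geo9Y x).supNorm (Sum.inl f) := by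
    show hqTP (toKT x.toKIdx) ε f ≤ hqTP (toKT x.toKIdx) (β' + ε) f + 2 * (toKT x.toKIdx).supF f
    exact hqTP_mono_add x.toKIdx hε0 (by linarith) f
  -- the (3.45) member of the reading at the product: a ⨆ of `hqS`
  rw [KSC₇_h2_inl]
  show (⨆ E : BallY 𝔸, ⨆ μ : Fin (d + 1), ⨆ ν : Fin (d + 1), hqS x.toKIdx (par U) β'
    (fun w => ((ζ₀ w : ℝ) : ℂ) • cdS x.toKIdx U μ (TW (cdsS x.toKIdx U ν (liftY f (E : 𝔸)))) w)) ≤ _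
  refine Real.iSup_le (fun E => Real.iSup_le (fun μ => Real.iSup_le (fun ν => hqS_le_of_forall x.toKIdx (par U) β' _ hRHS
    fun z z' hne => ?_) hRHS) hRHS) hRHS
  have hE1 : ‖(E : 𝔸)‖ ≤ 1 := mem_closedBall_zero_iff.1 E.2
  set X : SiteY x.toKIdx → 𝔸 := cdS x.toKIdx U μ (TW (cdsS x.toKIdx U ν (liftY f (E : 𝔸)))) with hX
  -- the pair quotient is the norm of the probe
  have hquot : ‖B9Eq39Adjoint.R (par U z z') ((((ζ₀ z' : ℝ) : ℂ)) • X z') - (((ζ₀ z : ℝ) : ℂ)) • X z‖ / denS x.toKIdx β' z z' =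
      ‖probeH x.toKIdx (par U) β' ζ₀ z z' X‖ := by rw [norm_probeH]; rfl
  rw [hquot]
  -- trivial cut-off
  by_cases hζ0 : ∀ w, ζ₀ w = 0
  · rw [probeH_apply]
    simp only [hζ0, Complex.ofReal_zero, zero_smul, B9Eq39Adjoint.R_zero, sub_zero, smul_zero, norm_zero]
    exact hRHS
  push Not at hζ0
  obtain ⟨w₀, hw₀⟩ := hζ0
  -- the anchor
  set y₁ : IBondY x.toKIdx := blkC x.toKIdx ιB w₀ with hy₁
  have hy₁β : β x.toKIdx.hN x.toKIdx.D x.toKIdx.hk y₁ = β x.toKIdx.hN x.toKIdx.D x.toKIdx.hk y := by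
    show β x.toKIdx.hN x.toKIdx.D x.toKIdx.hk (ιB (blkY x.toKIdx w₀)) = _; rw [hι, hζ' w₀ hw₀]
  have hlen : (geo9Y x).len y₁ = (geo9Y x).len y := geo9K_len_congr x.toKIdx hy₁β
  have hdist : ∀ t : IBondY x.toKIdx, (geo9Y x).dist y₁ t = (geo9Y x).dist y t := fun t => geo9K_dist_congr x.toKIdx hy₁β rfl
  set yL : IBondY x.toKIdx := ιB (β x.toKIdx.hN x.toKIdx.D x.toKIdx.hk y') with hyL
  have hyLβ : β x.toKIdx.hN x.toKIdx.D x.toKIdx.hk yL = β x.toKIdx.hN x.toKIdx.D x.toKIdx.hk y' := hι _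
  have hdistL : (geo9Y x).dist y₁ yL = (geo9Y x).dist y y' := geo9K_dist_congr x.toKIdx hy₁β (hι _)
  have hlamL : (geo9Y x).suppIn (Sum.inl f) yL := by
    intro w hw; show B6Geom246MultiLevelBox.blkOf x.toKIdx.D.toDomains w = β x.toKIdx.hN x.toKIdx.D x.toKIdx.hk yL
    rw [hyLβ]; exact hlam' w hw
  have hleny₁ : 0 < (geo9Y x).len y₁ := geo9Y_len_pos x y₁
  haveI : Nontrivial 𝔸 := NormOneClass.nontrivial
  obtain ⟨j₀⟩ := b.index_nonempty
  have hp₀ : blkC x.toKIdx ιB ((w₀, j₀) : SiteY x.toKIdx × ι).1 = y₁ := rfl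
  set cζ : ℝ := (geo9Y x).cutH β' (Sum.inl ζ₀) with hcζ
  have hcζ0 : 0 ≤ cζ := hcutH
  set Bp : ℝ := max (Bβ β') 0 with hBp
  have hBp0 : 0 ≤ Bp := le_max_right _ _
  set Bpe : ℝ := max (Bε ε) 0 with hBpe
  have hBpe0 : 0 ≤ Bpe := le_max_right _ _
  set Bp2 : ℝ := max (Bεβ ε β') 0 with hBp2
  have hBp20 : 0 ≤ Bp2 := le_max_right _ _
  set BhL : ℝ := Sb * Bp with hBhL
  have hBhL0 : 0 ≤ BhL := mul_nonneg hSb0 hBp0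
  -- the letters of the output word, the probe, the input
  set Dl : Module.End ℝ (SiteY x.toKIdx × ι → ℝ) := conj b (gradLetterF (shiftY x.toKIdx) (UboxY x.toKIdx U) ((((etaS x.toKIdx : ℝ) : ℂ))⁻¹) μ) with hDl
  set Ds : Module.End ℝ (SiteY x.toKIdx × ι → ℝ) :=
    conj b (diffLetter (shiftY x.toKIdx) (coordC G x.toKIdx (.base U)) ((((geo9Y x).eta : ℂ))⁻¹) (Sum.inr ν)) with hDs
  have hDsU : Ds = conj b (-gradLetterB (shiftY x.toKIdx) (UboxY x.toKIdx U) ((((etaS x.toKIdx : ℝ) : ℂ))⁻¹) ν) := by rw [hDs, hDk, diffLetter_inr]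
  have hDlU : Dl = conj b (diffLetter (shiftY x.toKIdx) (coordC G x.toKIdx (.base U)) ((((geo9Y x).eta : ℂ))⁻¹) (Sum.inl μ)) := by
    rw [hDl, hDk, diffLetter_inl]
  set Φ : (SiteY x.toKIdx → 𝔸) →ₗ[ℝ] 𝔸 := probeH x.toKIdx (par U) β' ζ₀ z z' with hΦ
  have hmajL : HasMajorant (g := toB6 (geo9Y x) (0 : ℝ) True) (fun p : SiteY x.toKIdx × ι => blkC x.toKIdx ιB p.1) (Dl * GopC x.toKIdx par b (.base U))
      (fun a a' => cR * B₀ * (geo9Y x).len a * Real.exp (-(δc * (geo9Y x).dist a a'))) := by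
    rw [hDlU]; exact hasMajorant_mono _ (hm1 (Sum.inl μ)) hlow
  have hmajR : HasMajorant (g := toB6 (geo9Y x) (0 : ℝ) True) (fun p : SiteY x.toKIdx × ι => blkC x.toKIdx ιB p.1) (GopC x.toKIdx par b (.base U) * Ds)
      (fun a a' => cR * B₀ * (geo9Y x).len a * Real.exp (-(δc * (geo9Y x).dist a a'))) :=
    hasMajorant_mono _ (hm2 (Sum.inr ν)) hlow
  have hBS : BlockSupp (g := toB6 (geo9Y x) (0 : ℝ) True) (fun p : SiteY x.toKIdx × ι => blkC x.toKIdx ιB p.1)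
      (coordEquiv b (liftY f (E : 𝔸))) yL (M₂ * (geo9Y x).supNorm (Sum.inl f)) :=
    blockSupp_coordEquiv_liftY x.toKIdx b ιB hM₂ hrepr f y' hlam' hE1
  have hliftE : (coordEquiv b).symm (coordEquiv b (liftY f (E : 𝔸))) = liftY f (E : 𝔸) := LinearEquiv.symm_apply_apply _ _
  -- (A) the LEFT Hölder probes of `D_l·G′(U)` at block-supported inputs, from the (3.43) block at the base
  set Wf : IBondY x.toKIdx → ℝ := fun a' => Bp * (geo9Y x).len y₁ ^ (1 - β') * cζ * Real.exp (-(δc * (geo9Y x).dist y₁ a')) with hWf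
  have hWf0 : ∀ a', 0 ≤ Wf a' := fun a' =>
    mul_nonneg (mul_nonneg (mul_nonneg hBp0 (Real.rpow_nonneg hleny₁.le _)) hcζ0) (Real.exp_pos _).le
  have hreadU : ∀ (g : SiteY x.toKIdx → ℝ) (a' : IBondY x.toKIdx), (geo9Y x).suppIn (Sum.inl g) a' →
      h1ReadT x.toKIdx TU (par U) U g β' ζ₀ ≤ Wf a' * (geo9Y x).supNorm (Sum.inl g) := by
    intro g a' hg
    have h := hH1' β' (Sum.inl g) (Sum.inl ζ₀) y a' hβ0 hβ1 hζ hg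
    rw [KSC₅_h1_inl] at h
    have hN : 0 ≤ (geo9Y x).supNorm (Sum.inl g) := (modelSignsOn_geo9K x.toKIdx).supNorm_nonneg _
    refine (show h1ReadT x.toKIdx TU (par U) U g β' ζ₀ ≤ _ from h).trans ?_
    rw [← hlen, ← hdist]
    have hP : 0 ≤ (geo9Y x).len y₁ ^ (1 - β') * cζ := mul_nonneg (Real.rpow_nonneg hleny₁.le _) hcζ0
    have hexp : Real.exp (-(δ * (geo9Y x).dist y₁ a')) ≤ Real.exp (-(δc * (geo9Y x).dist y₁ a')) :=
      Real.exp_le_exp.2 (by nlinarith [geo9Y_dist_nonneg x y₁ a'])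
    calc Bβ β' * (geo9Y x).len y₁ ^ (1 - β') * (geo9Y x).cutH β' (Sum.inl ζ₀) * Real.exp (-(δ * (geo9Y x).dist y₁ a')) *
          (geo9Y x).supNorm (Sum.inl g)
        = Bβ β' * (((geo9Y x).len y₁ ^ (1 - β') * cζ) * Real.exp (-(δ * (geo9Y x).dist y₁ a')) * (geo9Y x).supNorm (Sum.inl g)) := by
          rw [hcζ]; ring
      _ ≤ Bp * (((geo9Y x).len y₁ ^ (1 - β') * cζ) * Real.exp (-(δc * (geo9Y x).dist y₁ a')) * (geo9Y x).supNorm (Sum.inl g)) := by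
          refine mul_le_mul (le_max_left _ _) ?_ (mul_nonneg (mul_nonneg hP (Real.exp_pos _).le) hN) hBp0
          exact mul_le_mul_of_nonneg_right (mul_le_mul_of_nonneg_left hexp hP) hN
      _ = Wf a' * (geo9Y x).supNorm (Sum.inl g) := by rw [hWf]; ring
  have premA : ∀ (y'' : IBondY x.toKIdx) (νv : SiteY x.toKIdx × ι → ℝ) (C : ℝ),
      BlockSupp (g := toB6 (geo9Y x) (0 : ℝ) True) (fun p : SiteY x.toKIdx × ι => blkC x.toKIdx ιB p.1) νv y'' C →
      ‖Φ ((coordEquiv b).symm (Dl (GopC x.toKIdx par b (.base U) νv)))‖ ≤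
        BhL * (geo9Y x).len y₁ ^ (1 - β') * cζ * Real.exp (-(δc * (geo9Y x).dist y₁ y'')) * C := by
    intro y'' νv C hν
    calc ‖Φ ((coordEquiv b).symm (Dl (GopC x.toKIdx par b (.base U) νv)))‖
        = quotS x.toKIdx (par U) β' (wordS x.toKIdx ζ₀ (cdSL x.toKIdx U μ ∘ₗ TU) ((coordEquiv b).symm νv)) z z' := by
          rw [quotS_wordS_eq, hGopU, ← Module.End.mul_apply, hDl, symm_gradF_G]; rfl
      _ ≤ Sb * (Wf y'' * C) := quotL_blockSupp_le x.toKIdx b ιB TU (par U) U hι hM₂ hrepr β' ζ₀ hWf0 hreadU hν μ hne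
      _ = BhL * (geo9Y x).len y₁ ^ (1 - β') * cζ * Real.exp (-(δc * (geo9Y x).dist y₁ y'')) * C := by rw [hWf, hBhL]; ring
  -- (N) the sup data of `∇♯_k·G′(U)·D_s` at the input, from the (3.44) block at the base
  have he4U : ∀ (μ' ν' : Fin (d + 1)) (w : SiteY x.toKIdx),
      ‖cdS x.toKIdx U μ' (TU (cdsS x.toKIdx U ν' (liftY f (E : 𝔸)))) w‖ ≤
        Bpe * Real.exp (-(δc * (geo9Y x).dist (blkC x.toKIdx ιB w) yL)) * ((geo9Y x).holder ε (Sum.inl f) + (geo9Y x).supNorm (Sum.inl f)) := by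
    intro μ' ν' w
    have hwb : blkY x.toKIdx w = β x.toKIdx.hN x.toKIdx.D x.toKIdx.hk (blkC x.toKIdx ιB w) := (hι _).symm
    refine (e4_read G x par C37 C38 hE4' hε0 hε1 f (blkC x.toKIdx ιB w) yL hlamL E μ' ν' hwb).trans ?_
    have hHS' : 0 ≤ (geo9Y x).holder ε (Sum.inl f) + (geo9Y x).supNorm (Sum.inl f) := add_nonneg hholε hsupN
    refine mul_le_mul_of_nonneg_right ?_ hHS'
    have hexp : Real.exp (-(δ * (geo9Y x).dist (blkC x.toKIdx ιB w) yL)) ≤ Real.exp (-(δc * (geo9Y x).dist (blkC x.toKIdx ιB w) yL)) :=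
      Real.exp_le_exp.2 (by nlinarith [geo9Y_dist_nonneg x (blkC x.toKIdx ιB w) yL])
    calc Bε ε * Real.exp (-(δ * (geo9Y x).dist (blkC x.toKIdx ιB w) yL))
        ≤ Bpe * Real.exp (-(δ * (geo9Y x).dist (blkC x.toKIdx ιB w) yL)) := mul_le_mul_of_nonneg_right (le_max_left _ _) (Real.exp_pos _).le
      _ ≤ Bpe * Real.exp (-(δc * (geo9Y x).dist (blkC x.toKIdx ιB w) yL)) := mul_le_mul_of_nonneg_left hexp hBpe0
  have he4U' : ∀ (μ' ν' : Fin (d + 1)) (w : SiteY x.toKIdx),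
      ‖cdsS x.toKIdx U μ' (TU (cdsS x.toKIdx U ν' (liftY f (E : 𝔸)))) w‖ ≤
        Bpe * Real.exp (δc * (2 * ((d : ℝ) + 1))) * Real.exp (-(δc * (geo9Y x).dist (blkC x.toKIdx ιB w) yL)) *
          ((geo9Y x).holder ε (Sum.inl f) + (geo9Y x).supNorm (Sum.inl f)) := by
    intro μ' ν' w
    refine (norm_cdsS_le_norm_cdS_symm_shift x.toKIdx U hUu μ' _ w).trans ((he4U μ' ν' _).trans ?_)
    have hHS' : 0 ≤ (geo9Y x).holder ε (Sum.inl f) + (geo9Y x).supNorm (Sum.inl f) := add_nonneg hholε hsupN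
    refine mul_le_mul_of_nonneg_right ?_ hHS'
    rw [mul_assoc]
    refine mul_le_mul_of_nonneg_left ?_ hBpe0
    rw [← Real.exp_add]
    refine Real.exp_le_exp.2 ?_
    have hst := stencilB_blkC x.toKIdx ιB hι μ' w
    have htri := geo9Y_dist_triangle x (blkC x.toKIdx ιB w) (blkC x.toKIdx ιB ((shiftY x.toKIdx μ').symm w)) yL
    have h3 : (geo9Y x).dist (blkC x.toKIdx ιB w) yL ≤ 2 * ((d : ℝ) + 1) + (geo9Y x).dist (blkC x.toKIdx ιB ((shiftY x.toKIdx μ').symm w)) yL := by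
      have hst' : (geo9Y x).dist (blkC x.toKIdx ιB w) (blkC x.toKIdx ιB ((shiftY x.toKIdx μ').symm w)) ≤ 2 * ((d : ℝ) + 1) := hst
      linarith
    have h4 := mul_le_mul_of_nonneg_left h3 hδc.le
    rw [mul_add] at h4
    linarith
  set N : ℝ := M₂ * (Bpe * Real.exp (δc * (2 * ((d : ℝ) + 1))) * ((geo9Y x).holder ε (Sum.inl f) + (geo9Y x).supNorm (Sum.inl f))) with hN
  have hN0 : 0 ≤ N := by positivity
  have hN1 : ∀ (k : Fin (d + 1) ⊕ Fin (d + 1)) (zz : SiteY x.toKIdx × ι),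
      |(((conj b (diffLetter (shiftY x.toKIdx) (coordC G x.toKIdx (.base U)) ((((geo9Y x).eta : ℂ))⁻¹) k)) * GopC x.toKIdx par b (.base U) * Ds)
        (coordEquiv b (liftY f (E : 𝔸)))) zz| ≤ N * Real.exp (-(δc * (geo9Y x).dist (blkC x.toKIdx ιB zz.1) yL)) := by
    intro k zz
    refine (abs_apply_le_norm_symm x b hrepr _ zz).trans ?_
    rw [hDk, hGopU, hDsU]
    rcases k with μ' | μ'
    · rw [diffLetter_inl, norm_symm_gradF_G_negGradB x b TU U μ' ν _ zz.1, hliftE]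
      refine (mul_le_mul_of_nonneg_left (he4U μ' ν zz.1) hM₂).trans ?_
      rw [hN]
      have hone : (1 : ℝ) ≤ Real.exp (δc * (2 * ((d : ℝ) + 1))) := Real.one_le_exp (by positivity)
      have hHS' : 0 ≤ (geo9Y x).holder ε (Sum.inl f) + (geo9Y x).supNorm (Sum.inl f) := add_nonneg hholε hsupN
      have he0 : 0 ≤ Real.exp (-(δc * (geo9Y x).dist (blkC x.toKIdx ιB zz.1) yL)) := (Real.exp_pos _).le
      calc M₂ * (Bpe * Real.exp (-(δc * (geo9Y x).dist (blkC x.toKIdx ιB zz.1) yL)) * ((geo9Y x).holder ε (Sum.inl f) + (geo9Y x).supNorm (Sum.inl f)))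
          = (M₂ * (Bpe * 1 * ((geo9Y x).holder ε (Sum.inl f) + (geo9Y x).supNorm (Sum.inl f)))) *
              Real.exp (-(δc * (geo9Y x).dist (blkC x.toKIdx ιB zz.1) yL)) := by ring
        _ ≤ (M₂ * (Bpe * Real.exp (δc * (2 * ((d : ℝ) + 1))) * ((geo9Y x).holder ε (Sum.inl f) + (geo9Y x).supNorm (Sum.inl f)))) *
              Real.exp (-(δc * (geo9Y x).dist (blkC x.toKIdx ιB zz.1) yL)) := by
            refine mul_le_mul_of_nonneg_right (mul_le_mul_of_nonneg_left ?_ hM₂) he0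
            exact mul_le_mul_of_nonneg_right (mul_le_mul_of_nonneg_left hone hBpe0) hHS'
    · rw [diffLetter_inr, norm_symm_negGradB_G_negGradB x b TU U μ' ν _ zz.1, hliftE]
      refine (mul_le_mul_of_nonneg_left (he4U' μ' ν zz.1) hM₂).trans (le_of_eq ?_)
      rw [hN]; ring
  -- (N₂) the probe of the unperturbed word, from the (3.45) block at the base
  set N₂ : ℝ := Bp2 * (geo9Y x).len y₁ ^ (-β') * cζ * ((geo9Y x).holder (β' + ε) (Sum.inl f) + (geo9Y x).supNorm (Sum.inl f)) with hN₂
  have hN₂0 : 0 ≤ N₂ := mul_nonneg (mul_nonneg (mul_nonneg hBp20 (Real.rpow_nonneg hleny₁.le _)) hcζ0) (add_nonneg hhol hsupN)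
  have hN2 : ‖Φ ((coordEquiv b).symm ((Dl * GopC x.toKIdx par b (.base U) * Ds) (coordEquiv b (liftY f (E : 𝔸)))))‖ ≤
      N₂ * Real.exp (-(δc * (geo9Y x).dist y₁ yL)) := by
    rw [hGopU, hDsU, hDl, symm_gradF_G_negGradB_eq x b TU U μ ν, hliftE, map_neg, norm_neg, norm_probeH]
    refine (h2_read G x par b C37 C38 hM₂ hrepr hH2' hε0 hε1 hβ0 hβ1 f ζ₀ y y' hζ hlam' E μ ν hne).trans ?_
    rw [← hlen, ← hdistL, hN₂]
    have hexp : Real.exp (-(δ * (geo9Y x).dist y₁ yL)) ≤ Real.exp (-(δc * (geo9Y x).dist y₁ yL)) :=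
      Real.exp_le_exp.2 (by nlinarith [geo9Y_dist_nonneg x y₁ yL])
    have hP : 0 ≤ (geo9Y x).len y₁ ^ (-β') * cζ * ((geo9Y x).holder (β' + ε) (Sum.inl f) + (geo9Y x).supNorm (Sum.inl f)) :=
      mul_nonneg (mul_nonneg (Real.rpow_nonneg hleny₁.le _) hcζ0) (add_nonneg hhol hsupN)
    calc Bεβ ε β' * (geo9Y x).len y₁ ^ (-β') * (geo9Y x).cutH β' (Sum.inl ζ₀) * Real.exp (-(δ * (geo9Y x).dist y₁ yL)) *
          ((geo9Y x).holder (β' + ε) (Sum.inl f) + (geo9Y x).supNorm (Sum.inl f))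
        = Bεβ ε β' * (((geo9Y x).len y₁ ^ (-β') * cζ * ((geo9Y x).holder (β' + ε) (Sum.inl f) + (geo9Y x).supNorm (Sum.inl f))) *
            Real.exp (-(δ * (geo9Y x).dist y₁ yL))) := by rw [hcζ]; ring
      _ ≤ Bp2 * (((geo9Y x).len y₁ ^ (-β') * cζ * ((geo9Y x).holder (β' + ε) (Sum.inl f) + (geo9Y x).supNorm (Sum.inl f))) *
            Real.exp (-(δc * (geo9Y x).dist y₁ yL))) :=
          mul_le_mul (le_max_left _ _) (mul_le_mul_of_nonneg_left hexp hP) (mul_nonneg hP (Real.exp_pos _).le) hBp20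
      _ = _ := by ring
  -- the transfer
  have hout := HVI Dl Ds hmajL hmajR Φ y₁ (w₀, j₀) hp₀ β' BhL cζ hBhL0 hcζ0 premA yL (coordEquiv b (liftY f (E : 𝔸))) _ hBS N hN0 hN1 N₂ hN₂0 hN2
  have hval : ‖Φ X‖ = ‖Φ ((coordEquiv b).symm ((Dl * GopC x.toKIdx par b ((codingYx G x C37 C38).bg.mul (.mult a) (.base U)) * Ds)
      (coordEquiv b (liftY f (E : 𝔸)))))‖ := by
    rw [hGopW, hDsU, hDl, symm_gradF_G_negGradB_eq x b TW U μ ν, hliftE, map_neg, norm_neg]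
  rw [hval]
  refine hout.trans ?_
  rw [hlen, hdistL]
  -- arithmetic
  set L : ℝ := (geo9Y x).len y with hLdef
  set ee : ℝ := Real.exp (-(4 / 5 * δc * (geo9Y x).dist y y')) with hee
  have hee0 : 0 ≤ ee := (Real.exp_pos _).le
  set HS : ℝ := (geo9Y x).holder (β' + ε) (Sum.inl f) + (geo9Y x).supNorm (Sum.inl f) with hHSdef
  have hHS0 : 0 ≤ HS := add_nonneg hhol hsupN
  have hLm : L ^ (1 - β') * L⁻¹ = L ^ (-β') := by
    rw [← Real.rpow_neg_one, ← Real.rpow_add hleny]; ring_nf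
  have hNM : N + M₂ * (geo9Y x).supNorm (Sum.inl f) ≤ 3 * M₂ * (Bpe * Real.exp (δc * (2 * ((d : ℝ) + 1))) + 1) * HS := by
    rw [hN, hHSdef]
    have hc0 : 0 ≤ M₂ * (Bpe * Real.exp (δc * (2 * ((d : ℝ) + 1))) + 1) := by positivity
    have h1 : (geo9Y x).holder ε (Sum.inl f) + (geo9Y x).supNorm (Sum.inl f) ≤
        3 * ((geo9Y x).holder (β' + ε) (Sum.inl f) + (geo9Y x).supNorm (Sum.inl f)) := by nlinarith
    have h2 : (geo9Y x).supNorm (Sum.inl f) ≤ 3 * ((geo9Y x).holder (β' + ε) (Sum.inl f) + (geo9Y x).supNorm (Sum.inl f)) := by nlinarith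
    have hA : 0 ≤ M₂ * (Bpe * Real.exp (δc * (2 * ((d : ℝ) + 1)))) := by positivity
    calc M₂ * (Bpe * Real.exp (δc * (2 * ((d : ℝ) + 1))) * ((geo9Y x).holder ε (Sum.inl f) + (geo9Y x).supNorm (Sum.inl f))) +
          M₂ * (geo9Y x).supNorm (Sum.inl f)
        = (M₂ * (Bpe * Real.exp (δc * (2 * ((d : ℝ) + 1))))) * ((geo9Y x).holder ε (Sum.inl f) + (geo9Y x).supNorm (Sum.inl f)) +
            M₂ * (geo9Y x).supNorm (Sum.inl f) := by ring
      _ ≤ (M₂ * (Bpe * Real.exp (δc * (2 * ((d : ℝ) + 1))))) * (3 * ((geo9Y x).holder (β' + ε) (Sum.inl f) + (geo9Y x).supNorm (Sum.inl f))) +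
            M₂ * (3 * ((geo9Y x).holder (β' + ε) (Sum.inl f) + (geo9Y x).supNorm (Sum.inl f))) :=
          add_le_add (mul_le_mul_of_nonneg_left h1 hA) (mul_le_mul_of_nonneg_left h2 hM₂)
      _ = 3 * M₂ * (Bpe * Real.exp (δc * (2 * ((d : ℝ) + 1))) + 1) * ((geo9Y x).holder (β' + ε) (Sum.inl f) + (geo9Y x).supNorm (Sum.inl f)) := by
          ring
  have hNMnn : 0 ≤ N + M₂ * (geo9Y x).supNorm (Sum.inl f) := add_nonneg hN0 (mul_nonneg hM₂ hsupN)
  have hterm2 : BhL * L ^ (1 - β') * cζ * L⁻¹ * (N + M₂ * (geo9Y x).supNorm (Sum.inl f)) ≤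
      BhL * cζ * L ^ (-β') * (3 * M₂ * (Bpe * Real.exp (δc * (2 * ((d : ℝ) + 1))) + 1) * HS) := by
    calc BhL * L ^ (1 - β') * cζ * L⁻¹ * (N + M₂ * (geo9Y x).supNorm (Sum.inl f))
        = BhL * cζ * (L ^ (1 - β') * L⁻¹) * (N + M₂ * (geo9Y x).supNorm (Sum.inl f)) := by ring
      _ = BhL * cζ * L ^ (-β') * (N + M₂ * (geo9Y x).supNorm (Sum.inl f)) := by rw [hLm]
      _ ≤ BhL * cζ * L ^ (-β') * (3 * M₂ * (Bpe * Real.exp (δc * (2 * ((d : ℝ) + 1))) + 1) * HS) :=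
          mul_le_mul_of_nonneg_left hNM (mul_nonneg (mul_nonneg hBhL0 hcζ0) (Real.rpow_nonneg hleny.le _))
  have hterm1 : N₂ = Bp2 * L ^ (-β') * cζ * HS := by rw [hN₂, hlen]
  calc B * (N₂ + BhL * L ^ (1 - β') * cζ * L⁻¹ * (N + M₂ * (geo9Y x).supNorm (Sum.inl f))) * ee
      ≤ B * (Bp2 * L ^ (-β') * cζ * HS + BhL * cζ * L ^ (-β') * (3 * M₂ * (Bpe * Real.exp (δc * (2 * ((d : ℝ) + 1))) + 1) * HS)) * ee := by
        refine mul_le_mul_of_nonneg_right (mul_le_mul_of_nonneg_left ?_ hB) hee0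
        rw [hterm1]
        exact add_le_add le_rfl hterm2
    _ = wH2₇ (2 * ((d : ℝ) + 1)) Sb M₂ B δc Bβ Bε Bεβ ε β' * L ^ (-β') * cζ * ee * HS := by
        rw [wH2₇, ← hBp, ← hBpe, ← hBp2, hBhL]; ring

end Transfer

/-! ## §5 ★★ The frame instance over the coded carriers of a subfamily and the (3.45) block-steps -/

section Steps

variable [NormOneClass 𝔸] {J : Type} (f : J → MemberY d ℓ hd hL b₀ b₁ Mstar) [∀ x : MemberY d ℓ hd hL b₀ b₁ Mstar, Fintype (geo9Y x).Site]
  [instDS : ∀ x : MemberY d ℓ hd hL b₀ b₁ Mstar, DecidableEq (geo9Y x).Site] [instNE : ∀ x : MemberY d ℓ hd hL b₀ b₁ Mstar, Nonempty (geo9Y x).Site]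
  (c35 : ℝ) (G : Subgroup 𝔸ˣ) (par : ∀ j : J, SiteParY 𝔸 (f j).toKIdx) (OA : ∀ j : J, BondOpY 𝔸 (f j).toKIdx)
  (parB : ∀ j : J, BondParY 𝔸 (f j).toKIdx) {ι : Type} [Fintype ι] [DecidableEq ι] (b : Module.Basis ι ℝ 𝔸)
  (ιB : ∀ j : J, BlkY (f j).toKIdx → IBondY (f j).toKIdx)
  (C37 C38 : ∀ j : J, ℝ → CfgY 𝔸 (f j).toKIdx → AfldY 𝔸 (f j).toKIdx → Prop)
  (Cinv : ∀ j : J, B9.SiteKernel (geo9Y (f j)) (bg9Y 𝔸 G (f j)))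

/-- ★★ **THE (3.45) FRAME OVER THE CODED CARRIERS OF A SUBFAMILY, INHABITED FOR `KSC₇`** (root frame `gpFrame₂CodedOn` with `KSC₇`'s dictionaries, writing function
`wH2₇`, rate `4δc∕5`, transfer field `h2_transfer_KSC₇`); no hypothesis beyond the root frame's.
[cite: Balaban1985BackgroundPropagators, Thm 3.4 p.400, (3.45) p.398, p.403 l.2–5, (3.60)–(3.65) pp.402–403; Balaban1984PropagatorsII, Lemma 2.1 p.234, (2.51)–(2.52) p.232] -/
noncomputable def h2Frame₃CodedOn (hι : ∀ (j : J) (s : BlkY (f j).toKIdx), β (f j).toKIdx.hN (f j).toKIdx.D (f j).toKIdx.hk (ιB j s) = s)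
    (hG1 : ∀ u : 𝔸ˣ, u ∈ G → ‖(u : 𝔸)‖ ≤ 1) (hpar : ∀ j (U : CfgY 𝔸 (f j).toKIdx), GVal G (f j).toKIdx U → ∀ z w, par j U z w ∈ G)
    (hunit : ∀ j (U : CfgY 𝔸 (f j).toKIdx), GVal G (f j).toKIdx U → IsUnit (deltaPrimeAY (f j).toKIdx (par j) U))
    (dB : ℕ) (M₂ : ℝ) (hM₂ : 0 ≤ M₂) (hrepr : ∀ (v : 𝔸) (j : ι), |b.repr v j| ≤ M₂ * ‖v‖) (hcR : 0 < M₂ * ∑ j, ‖b j‖)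
    (Cq : ℝ) (hCq : 0 ≤ Cq) (hC37 : ∀ j β' U a, C37 j β' U a → GVal G (f j).toKIdx U ∧ CplxLettersY G (f j) (par j) (ιB j) Cq β' U a)
    (MInv aInv aW : ℝ) (hMInv : 0 < MInv) (haInv : 0 < aInv) (haW : 0 < aW) :
    H2Frame₃ c35 (fun j => geo9Y (f j)) (fun j => (codingYx G (f j) (C37 j) (C38 j)).bg) (fun j => KSC₇ G (f j) (par j) (C37 j) (C38 j)) b
      (Fin (d + 1)) (fun j => SiteY (f j).toKIdx) :=
  { gpFrame₂CodedOn f c35 G b C37 C38 par ιB (fun j => KSC₇ G (f j) (par j) (C37 j) (C38 j)) hι hG1 hpar hunit dB M₂ hM₂ hrepr Cq hCq hC37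
      (M₂ * ∑ j, ‖b j‖) hcR (fun B _ => (M₂ * ∑ j, ‖b j‖) * B + 1) (fun B _ hB _ => by positivity) (fun δ => δ) (fun δ hδ => hδ)
      MInv aInv aW hMInv haInv haW (fun j => read342Y_KSC₇ G (f j) (par j) b (ιB j) (C37 j) (C38 j) (hι j) M₂ hM₂ hrepr c35 MInv aInv)
      (fun j => write342Y_KSC₇ G (f j) (par j) b (ιB j) (C37 j) (C38 j) (hι j) M₂ hM₂ hrepr aW fun β' U a h => (hC37 j β' U a h).1) with
    wH2 := fun B δc Bβ Bε Bεβ => wH2₇ (2 * ((d : ℝ) + 1)) (∑ j, ‖b j‖) M₂ B δc Bβ Bε Bεβ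
    wH2δ := fun δc => 4 / 5 * δc
    wH2δ_pos := fun δc hδc => by positivity
    h2_transfer := fun j α₀ c c' α₁ B₀ B δ δc Bβ Bε Bεβ hM hα₀ hMa hreg hα₁ haW' h37 hB₀ hB hδ hδc hδcδ hE hHol HVI =>
      h2_transfer_KSC₇ c35 G (f j) (par j) b (ιB j) (C37 j) (C38 j) (hι j) hG1 hM₂ hrepr hcR
        (read342Y_KSC₇ G (f j) (par j) b (ιB j) (C37 j) (C38 j) (hι j) M₂ hM₂ hrepr c35 MInv aInv)
        α₀ c c' α₁ B₀ B δ δc Bβ Bε Bεβ hM hα₀ hMa hreg hα₁ haW' h37 hB₀ hB hδ hδc hδcδ hE hHol HVI }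

/-- ★★ **`StepH2Pos` OF `KSC₇` OVER THE CODED CARRIERS** (any shared `GA`, `Cinv`). [cite: Balaban1985BackgroundPropagators, Thm 3.4 p.400, (3.45) p.398, p.403 l.2–5; Balaban1984PropagatorsII, Lemma 2.1 p.234] -/
theorem stepH2Pos_KSC₇_on (hι : ∀ (j : J) (s : BlkY (f j).toKIdx), β (f j).toKIdx.hN (f j).toKIdx.D (f j).toKIdx.hk (ιB j s) = s)
    (hG1 : ∀ u : 𝔸ˣ, u ∈ G → ‖(u : 𝔸)‖ ≤ 1) (hpar : ∀ j (U : CfgY 𝔸 (f j).toKIdx), GVal G (f j).toKIdx U → ∀ z w, par j U z w ∈ G)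
    (hunit : ∀ j (U : CfgY 𝔸 (f j).toKIdx), GVal G (f j).toKIdx U → IsUnit (deltaPrimeAY (f j).toKIdx (par j) U))
    (dB : ℕ) (M₂ : ℝ) (hM₂ : 0 ≤ M₂) (hrepr : ∀ (v : 𝔸) (j : ι), |b.repr v j| ≤ M₂ * ‖v‖) (hcR : 0 < M₂ * ∑ j, ‖b j‖)
    (Cq : ℝ) (hCq : 0 ≤ Cq) (hC37 : ∀ j β' U a, C37 j β' U a → GVal G (f j).toKIdx U ∧ CplxLettersY G (f j) (par j) (ιB j) Cq β' U a)
    (MInv aInv aW : ℝ) (hMInv : 0 < MInv) (haInv : 0 < aInv) (haW : 0 < aW)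
    (GA : ∀ j : J, B9.KernelFamily (geo9Y (f j)) (codingYx G (f j) (C37 j) (C38 j)).bg)
    (CinvC : ∀ j : J, B9.SiteKernel (geo9Y (f j)) (codingYx G (f j) (C37 j) (C38 j)).bg) :
    StepH2Pos dB c35 (fun j => geo9Y (f j)) (fun j => (codingYx G (f j) (C37 j) (C38 j)).bg) (fun j => KSC₇ G (f j) (par j) (C37 j) (C38 j)) GA CinvC
      (fun j => KSC₇ G (f j) (par j) (C37 j) (C38 j)) :=
  stepH2Pos_of_h2Frame₃ (d := dB)
    (h2Frame₃CodedOn f c35 G par b ιB C37 C38 hι hG1 hpar hunit dB M₂ hM₂ hrepr hcR Cq hCq hC37 MInv aInv aW hMInv haInv haW) GA CinvC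

omit [NormOneClass 𝔸] [FiniteDimensional ℝ 𝔸] [DecidableEq ι] instDS instNE in
/-- ★ **`hin` FOR `KSC₇` WITH POSITIVE OUTPUT CONSTANTS** (input families `(KSCU, KACU, pullS Cinv)`): g11's `hin_KSCU_on_pos` (output `KSC`) followed by the base
congruence `KSC ↦ KSC₇`. [cite: Balaban1985BackgroundPropagators, Thms 3.1–3.3 (3.42)–(3.48) pp.397–399, (3.35) p.396; Balaban1984PropagatorsII, (2.51) p.232] -/
theorem hin_KSC₇_on_pos (hι : ∀ (j : J) (s : BlkY (f j).toKIdx), β (f j).toKIdx.hN (f j).toKIdx.D (f j).toKIdx.hk (ιB j s) = s)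
    (hG1 : ∀ u : 𝔸ˣ, u ∈ G → ‖(u : 𝔸)‖ ≤ 1) {M₂ : ℝ} (hM₂ : 0 ≤ M₂) (hrepr : ∀ (v : 𝔸) (j : ι), |b.repr v j| ≤ M₂ * ‖v‖) (dC : ℕ) :
    ∀ (B₀ δ₀ : ℝ) (Bβ Bε : ℝ → ℝ) (Bεβ : ℝ → ℝ → ℝ) (B₁ δ₁ : ℝ), 0 < B₀ → 0 < δ₀ → 0 < B₁ → 0 < δ₁ →
      ∃ (Mi ai B₀' δ₀' : ℝ) (Bβ' Bε' : ℝ → ℝ) (Bεβ' : ℝ → ℝ → ℝ) (B₁' δ₁' : ℝ), 0 < ai ∧ 0 < B₀' ∧ 0 < δ₀' ∧ 0 < B₁' ∧ 0 < δ₁' ∧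
        ∀ j : J, Mi ≤ (geo9Y (f j)).M → ∀ α₀ : ℝ, 0 < α₀ → (geo9Y (f j)).M * α₀ ≤ ai →
          ∀ c : (codingYx G (f j) (C37 j) (C38 j)).bg.Cfg, (codingYx G (f j) (C37 j) (C38 j)).bg.Reg335 c35 α₀ c →
          B9.Thms31to33IneqAt dC (KSCU G (f j) (par j) (C37 j) (C38 j)) (KACU G (f j) (OA j) (parB j) (C37 j) (C38 j))
              (pullS (codingYx G (f j) (C37 j) (C38 j)) (Cinv j)) B₀ δ₀ Bβ Bε Bεβ B₁ δ₁ c →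
          B9.Thms31to33IneqAt dC (KSC₇ G (f j) (par j) (C37 j) (C38 j)) (KACU G (f j) (OA j) (parB j) (C37 j) (C38 j))
              (pullS (codingYx G (f j) (C37 j) (C38 j)) (Cinv j)) B₀' δ₀' Bβ' Bε' Bεβ' B₁' δ₁' c := by
  intro B₀ δ₀ Bβ Bε Bεβ B₁ δ₁ hB₀ hδ₀ hB₁ hδ₁
  obtain ⟨Mi, ai, B₀', δ₀', Bβ', Bε', Bεβ', B₁', δ₁', hai, hB₀', hδ₀', hB₁', hδ₁', H⟩ :=
    hin_KSCU_on_pos f c35 G par OA parB b ιB C37 C38 Cinv hι hG1 hM₂ hrepr dC B₀ δ₀ Bβ Bε Bεβ B₁ δ₁ hB₀ hδ₀ hB₁ hδ₁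
  refine ⟨Mi, ai, B₀', δ₀', Bβ', Bε', Bεβ', B₁', δ₁', hai, hB₀', hδ₀', hB₁', hδ₁', fun j hM α₀ hα₀ hMa c hreg hT => ?_⟩
  obtain ⟨U, rfl, -⟩ := (codingYx G (f j) (C37 j) (C38 j)).exists_of_bg_Reg335 hreg
  obtain ⟨⟨h42, h43⟩, hC, hG⟩ := H j hM α₀ hα₀ hMa _ hreg hT
  obtain ⟨se, sh1, se4, sh2, sl2, sg⟩ := KSC₇_members_base G (f j) (par j) (C37 j) (C38 j) U
  exact ⟨⟨ineq342_346_347_congr G (f j) (C37 j) (C38 j) _ _ (fun n => (se n).symm) (fun n => (sl2 n).symm) (fun n => (sg n).symm) _ _ h42,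
    ineq343_345_congr G (f j) (C37 j) (C38 j) _ _ sh1.symm se4.symm sh2.symm _ _ _ _ h43⟩, hC, hG⟩

/-- ★★ **`StepH2Pos` OF `KSCU` OVER THE CODED CARRIER — THE (3.45) MEMBER OF THE SECT.-B STEP OF RECORD IN PRINT's READING (R13-U1), G′ SIDE** (input
families `(KSCU, KACU, pullS Cinv)`, output `KSCU`'s (3.45) block at the product): `stepH2Pos_KSC₇_on` (with `GA := KACU`, `Cinv := pullS Cinv`) transported
by `stepH2Pos_of_family_pos` — `hin_KSC₇_on_pos`, identity output (`KSC₇.h2 = KSCU.h2`).  Binders = those of `B9SectBStepsKSCUBlocks.stepEPos_KSCU_on`.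
[cite: Balaban1985BackgroundPropagators, Thm 3.4 p.400, (3.45) p.398, p.403 l.2–5, (3.60)–(3.65) pp.402–403, (3.35)–(3.37) p.396; Balaban1984PropagatorsII, Lemma 2.1 p.234, (2.51)–(2.52) p.232] -/
theorem stepH2Pos_KSCU_on (hι : ∀ (j : J) (s : BlkY (f j).toKIdx), β (f j).toKIdx.hN (f j).toKIdx.D (f j).toKIdx.hk (ιB j s) = s)
    (hG1 : ∀ u : 𝔸ˣ, u ∈ G → ‖(u : 𝔸)‖ ≤ 1) (hpar : ∀ j (U : CfgY 𝔸 (f j).toKIdx), GVal G (f j).toKIdx U → ∀ z w, par j U z w ∈ G)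
    (hunit : ∀ j (U : CfgY 𝔸 (f j).toKIdx), GVal G (f j).toKIdx U → IsUnit (deltaPrimeAY (f j).toKIdx (par j) U))
    (dB : ℕ) (M₂ : ℝ) (hM₂ : 0 ≤ M₂) (hrepr : ∀ (v : 𝔸) (j : ι), |b.repr v j| ≤ M₂ * ‖v‖) (hcR : 0 < M₂ * ∑ j, ‖b j‖)
    (Cq : ℝ) (hCq : 0 ≤ Cq) (hC37 : ∀ j β' U a, C37 j β' U a → GVal G (f j).toKIdx U ∧ CplxLettersY G (f j) (par j) (ιB j) Cq β' U a)
    (MInv aInv aW : ℝ) (hMInv : 0 < MInv) (haInv : 0 < aInv) (haW : 0 < aW) :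
    StepH2Pos dB c35 (fun j => geo9Y (f j)) (fun j => (codingYx G (f j) (C37 j) (C38 j)).bg)
      (fun j => KSCU G (f j) (par j) (C37 j) (C38 j)) (fun j => KACU G (f j) (OA j) (parB j) (C37 j) (C38 j))
      (fun j => pullS (codingYx G (f j) (C37 j) (C38 j)) (Cinv j)) (fun j => KSCU G (f j) (par j) (C37 j) (C38 j)) :=
  stepH2Pos_of_family_pos dB c35 (fun j => geo9Y (f j)) (fun j => (codingYx G (f j) (C37 j) (C38 j)).bg)
    (fun j => KSC₇ G (f j) (par j) (C37 j) (C38 j)) (fun j => KSCU G (f j) (par j) (C37 j) (C38 j))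
    (fun j => KACU G (f j) (OA j) (parB j) (C37 j) (C38 j)) (fun j => KACU G (f j) (OA j) (parB j) (C37 j) (C38 j))
    (fun j => pullS (codingYx G (f j) (C37 j) (C38 j)) (Cinv j))
    (fun j => KSC₇ G (f j) (par j) (C37 j) (C38 j)) (fun j => KSCU G (f j) (par j) (C37 j) (C38 j))
    (hin_KSC₇_on_pos f c35 G par OA parB b ιB C37 C38 Cinv hι hG1 hM₂ hrepr dB)
    (fun Bεβ δ a hδ ha => ⟨0, 1, a, Bεβ, δ, one_pos, ha, le_rfl, hδ, fun j _ _ _ _ _ _ _ _ _ _ _ h => (h2Block_KSC₇_iff G (f j) (par j) (C37 j) (C38 j) _).1 h⟩)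
    (stepH2Pos_KSC₇_on f c35 G par b ιB C37 C38 hι hG1 hpar hunit dB M₂ hM₂ hrepr hcR Cq hCq hC37 MInv aInv aW hMInv haInv haW _ _)

end Steps

end Literature.MathematicalPhysics.QuantumFieldTheory.Balaban1983to89.B9SectBH2FrameCodedY

end
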